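import Mathlib
import HarnessLib
import HarnessLib.Audit
import Summits.BirchSwinnertonDyer.Statement
import Summits.BirchSwinnertonDyer.Rank1Residual.WAll.TargetAdditiveAtThreeCells
import Literature.NumberTheory.EllipticCurves.QuadraticTwist
import Literature.NumberTheory.EllipticCurves.NonvanishingTwistsBumpFriedbergHoffstein
import Literature.NumberTheory.EllipticCurves.NonvanishingTwistsPrescribedSplitting
import Literature.NumberTheory.EllipticCurves.BSDRootNumber
import Literature.NumberTheory.EllipticCurves.CuspFormLFunction
import Literature.NumberTheory.EllipticCurves.HeegnerPoints
import Literature.NumberTheory.EllipticCurves.Kato2004.AdditivePotGoodRankZeroShaUpperBound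
import Literature.NumberTheory.EllipticCurves.HeegnerPointsRationalOverHilbertClassField
import Literature.NumberTheory.EllipticCurves.HeegnerPointsOfConductorGaloisConj
import Literature.NumberTheory.EllipticCurves.KolyvaginShaStructureCertificate
import Literature.NumberTheory.EllipticCurves.KolyvaginShaIndexBound
import Literature.NumberTheory.EllipticCurves.NonvanishingTwistsHoffsteinLuo
import Summits.BirchSwinnertonDyer.Rank1Residual.X11b.Three.KolyvaginNonvanishing
import Literature.NumberTheory.EllipticCurves.MatarNekovar2019.ShaStructureIrreducible
import Literature.NumberTheory.Automorphic.ShimuraCurveCartanLevel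
import Summits.BirchSwinnertonDyer.BirchSwinnertonDyer.Theorems.ClassRecordThreeCartanOnePlaceDegreeLawAtThreeNatural
import Literature.NumberTheory.Automorphic.ShimuraCurveRibetTakahashiComponentOrders
import Summits.BirchSwinnertonDyer.BirchSwinnertonDyer.Theorems.ManinLocalTwoThreeMazurManinConstantOddPrimes
import Summits.BirchSwinnertonDyer.BirchSwinnertonDyer.Theorems.ManinLocalTwoThreeAbbesUllmoCesnaviciusManinConstant
import HarnessLib.Audit.Status.Attr

/-!
Route: RamifiedHeegnerPair

# Route RamifiedHeegnerPair — Ramify 3 in the Heegner field - BSD_3 on the Gss2 cell from a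
3-ramified twist pair over which E becomes good supersingular at the prime above 3

It suffices to show the four MEMBER HALVES of BSD₃ on the W-ALL leaf `WAllExclAddGssAtThree` (Block
A: non-CM E/ℚ, additive at 3 of class Gss2 = `Additive.SubGss W 3`: e = 2, Kodaira I₀*, E = V₀ ⊗ χ₋₃
with V₀ good supersingular at 3; r_an ≤ 1; 1 060 isogeny classes of the census = r0 705 + r1 355): X
= L₁ ∧ U₁ ∧ L₀ ∧ U₀, where at analytic rank r the lower half L_r is `Typed.MissingLowerBoundAt E 3`
(#Ш(E)_an = q ∈ ℚ with ord₃ q ≤ ord₃ #Ш(E): the main-conjecture-⊇ / Gross–Zagier half) and the upper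
half U_r is `Typed.MissingUpperBoundAt E 3` (ord₃ #Ш(E) ≤ ord₃ q: the Euler-system half). REV 5
MEMBER CUT (2026-08-28, both line leads' promote-stub outcomes): items 26021
`Gss2LowerAtThreeRankOne` = L₁ (DECIDING), 26022 `LeafRankOneUpperAtThree` = U₁, 26023
`Gss2LowerAtThreeRankZero` = L₀ and 26024 `LeafRankZeroUpperAtThree` = U₀ (the rank-0 pair is the
declared residual: no seat of this route attacks it today). The LEVER is unchanged and is now the
LINE under the deciding crux: pair E with a 3-RAMIFIED imaginary quadratic twist — d = −3m < 0
squarefree with v₃(d) = 1, V = the minimal model of E^(d), which is GOOD supersingular at 3, r_an(E)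
+ r_an(V) = 1 — so that over K = ℚ(√d) the curve A = E/K ≅ V/K is good supersingular at the ramified
prime 𝔭 ∣ 3 with r_an(A/K) = 1. The former pair statements X1 = `RamifiedPairLowerBound` and X2 =
`RamifiedPairUpperBound` (items 23191/23192, now asides, texts unchanged) are EXACTLY L₀ ∧ L₁ and U₀
∧ U₁ modulo the route's twist supply, GZK and BSD₃ of the good partner (kernel: p606339
`RamifiedPairLowerBound.gssLowerAtThree_of_ramifiedPairLowerBound` /
`ramifiedPairLowerBound_of_gssLowerHalves_of_items`; p607424
`RamifiedPairUpperBound.ramifiedPairUpperBound_of_leafUpper_of_residual`), so the Heegner-point main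
conjecture ⊇ / signed anticyclotomic IMC ⊇ for A over the 3-ramified K proves L₁, and Kolyvagin's
CM-point Euler system (for the upper half no clause at p is needed, a split Heegner field K′ serves
as well as the ramified one) proves U₁ row by row up to the Tamagawa index at an additive 3. What
the cut buys: BSD₃ of good-supersingular curves (W-ALL rows 6/7/8 at p = 3, former residual 23193)
and the twist supply (25112/25113) leave the cone entirely; what it exposes: L₁ is the one statement
for which no engine is in print or announced (a 3-adic Gross–Zagier formula or a signed ⊇ at an
additive 3 over ℚ, equivalently at a ramified supersingular 𝔭 over K).
Lean: `∀ (W : WeierstrassCurve ℚ) [W.IsElliptic] [W.IsGloballyMinimal], ¬ W.HasCM →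
Literature.NumberTheory.EllipticCurves.Rank1Residual.Addv W 3 →
Summit.BirchSwinnertonDyer.Rank1Residual.Additive.SubGss W 3 → W.analyticRank = 1 →
Literature.NumberTheory.EllipticCurves.Rank1Residual.Typed.MissingLowerBoundAt W 3`

## Assembly
Pure bookkeeping in the tree's typed currency (the deciding theorem `closes`, certified at rev 5,
standard axioms): for E on the leaf split r_an(E) ≤ 1 into r = 0 or r = 1
(`Nat.le_one_iff_eq_zero_or_eq_one`); the two member halves at that rank give
`Typed.MissingLowerBoundAt E 3` and `Typed.MissingUpperBoundAt E 3`;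
`Typed.missingPPartAt_of_lower_of_upper` identifies the two rationals through `shaAn` and gives
`Typed.MissingPPartAt E 3`; `Typed.bsdp_of_missingPPartAt` with the published input GZK (item 19921:
rank = r_an and Ш finite for r_an ≤ 1) gives `BSDp E 3`. No pair, no auxiliary field, no residual
leaf and no twist supply enters the glue.

CLOSES_TARGET: closes rung W-ALL/2@3.GssAtThree of BirchSwinnertonDyer: Summit.BirchSwinnertonDyer.WAllExclAddGssAtThree (D-0061; not the summit Statement) — the deciding theorem of this route concludes that registered leaf instead of the Statement decl `BirchSwinnertonDyer` (class rung: servable and labelled, never counted as concluding the summit Statement).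

Rationale: WHY THIS LINE. At an additive potentially supersingular 3 every ℚ-based 3-adic engine is vacuous
(D_cris(V₃E|G_ℚ₃) = 0, no admissible primes since 3 ∣ ℓ² − 1:
`Literature.Barriers.BirchSwinnertonDyer.NoAdmissiblePrimesAtThree`, cell catalogue
BARRIERS-AT3-R1-pss3g3), and every Heegner route in the tree (AdditiveKolyvaginRoad,
UniversalToricDescent, SemiOrdinaryEisensteinDescent) keeps E ADDITIVE at 3 over a Heegner field in
which 3 splits, so the local theory at p stays additive (♯-frame, toric periods, Eisenstein descent
at the bad prime). The Gss2 cell is exactly the class where one quadratic base change repairs the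
prime: E = V₀ ⊗ χ₋₃ becomes GOOD supersingular over any K = ℚ(√−3m) (the tree lemma
`Summit.BirchSwinnertonDyer.Rank1Residual.O5.exists_goodSS_twist_pStar_of_subGss` is the d = −3 case
over ℚ), so we take the Heegner field itself 3-RAMIFIED: over K the local representation at 𝔭 ∣ 3 is
the restriction of the crystalline supersingular V₃(V) to the ramified quadratic K_𝔭, Gross–Zagier
is in print at joint ramification (CaiShuTian2014 Thm 1.5 with Special case 2: v ∣ (N, D) allowed,
Σ_D = {3} costs a factor 2⁻¹ and removes the Euler factor at 𝔭 [corpus: paper:arxiv-1408.1733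
p.6–7]), Kolyvagin's Euler system of CM points on X_U works for general level structure (Nekovar2007
Thm 3.2) with 3 ∤ 2·(K ∩ ℚ(E[3]) degree) automatic on the 257 onto classes (the only quadratic
subfield of ℚ(E[3]) is ℚ(√−3) ≠ K for m ≠ 1), and the analytic anticyclotomic object at a prime
inert OR RAMIFIED in K exists (Kriz2021 AMS-212: "allow p to be inert or ramified in K" [corpus:
book:kriz2021 p.10, p.16; galaxy:panama:391752557002789]). Imported from the arithmetic of quadratic
base change: BSD₃(E/K) = BSD₃(E) + BSD₃(E^(d)) on 3-primary parts (odd p), Artin formalism L(A/K,s)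
= L(E,s)L(E^(d),s), and the W-ALL table's own rows 6/7/8 for the GOOD partner V (residual, not
attacked). TRANSFER lens: the solved siblings are rank-one BSD_p at a good supersingular p with p
SPLIT in K (CastellaWan2022, signed BDP main conjecture) and the definite/indefinite theory at p
INERT (BurungaleBuyukbodukLei2024, p ≥ 5 [corpus: paper:arxiv-2211.03722 p.2];
BurungaleKobayashiOta2021/2023 for CM); the first non-transferring step is p RAMIFIED in K for a
non-CM curve — in print only the CM case exists (Burungale–Kobayashi–Nakamura–Ota 2026,
arXiv:2608.06879: "an Iwasawa-theoretic framework … has remained open" [corpus: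
paper:arxiv-2608.06879 p.3]) — and that step, at p = 3, is the deciding crux. What no prior route or
negatives entry does: nobody ramifies the residue prime in the Heegner field to make E/K good at 𝔭;
QBSC reaches the same cell only as a held residual of a cyclotomic η-branch argument typed for 5 ≤
p. REV 5 MEMBER CUT (2026-08-28; rhp-p1 g2 LOWER-HALVES-CORE.md §4 option B + rhp-p2 g2 RESTATE
DATUM v2, both leads ending promote-stub): the pair statements are, in the kernel, LOSSLESS sums of
the members' one-sided halves over ℚ (p606339: X1 ∧ twist supply ∧ BSD₃(good partner) ∧ GZK ⇒ L₀ ∧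
L₁ and L₀ ∧ L₁ ∧ GZK ∧ BSD₃(good partner) ⇒ X1; p607424 / X2-ENGINE-AUDIT v2: X2 ⟺ ∀ pairs
JointUpperBoundAt, the sum of U-halves) — so the route now files the members as its items and keeps
the ramified pair as the LINE under L₁. Gain: the W-ALL rows 6/7/8 at p = 3 (BSD₃ of
good-supersingular curves) and the BFH/FH/parity twist supply are no longer hypotheses of `closes`.
Exposure, stated plainly: L₁ (rank-one lower half at an additive potentially supersingular 3) has no
engine in print or announced; U₁ is Tamagawa-exact Kolyvagin at an additive 3 (print on 9 of 355
classes); L₀ is Kato-⊇ made index-exact at an additive 3 (announced on the Fouquet–Wan locus only);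
U₀ is Kato's divisibility made Tamagawa-exact (print on the Kato-sharp rows).

RANKED CRUXES. #2 Gss2LowerAtThreeRankOne (crux, 26021, DECIDING; text = X1 skeleton v3
`stub_gssLowerAtThree_rankOne` verbatim) — for every non-CM globally minimal E/ℚ of class Gss2 at 3
with r_an(E) = 1, #Ш(E)_an is a rational q with ord₃ q ≤ ord₃ #Ш(E) (`Typed.MissingLowerBoundAt E
3`). Roads: over the 3-ramified K, Heegner-point main conjecture ⊇ / signed anticyclotomic IMC ⊇ for
A = E/K (good supersingular at the ramified 𝔭, e = 2 = p − 1) + the explicit Gross–Zagier formula at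
joint ramification (CaiShuTian2014 Thm 1.5 sc2), then p606339 back to ℚ; over ℚ, a 3-adic
Gross–Zagier / Perrin-Riou formula on the ω-branch of V₀ at 3 (QBSC's declared residual
`PAdicGrossZagierBranch` read at p = 3); per class, a 3-descent exhibiting (ℤ/3)² ⊆ Ш(E)
(`LowerHalfDescentCore.missingLowerBoundAt_of_pow_dvd_of_analyticRank_le_one`, m = 2) — kernel fact
for that class only. [difficulty: open-problem] (why it might fail: no 3-adic Gross–Zagier / signed
IMC ⊇ is in print or announced at an additive 3 over ℚ or at a ramified supersingular 𝔭 over K —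
Kobayashi 2013 needs good p, Kriz's 𝓛 is continuous not Iwasawa, BKNO 2026 is CM and p ≥ 5;
class-wide nothing bounds ord₃ #Ш(E) from below.) [Kobayashi2013, Kriz2021, arXiv:2608.06879,
FouquetWan2021, Kobayashi2003, CastellaWan2022]
  FAMILY of #2 (SPLIT gen 1, rev 9, line kolyvagin_split of rhp-p1): PUB 27199
`Gss2LowerPrintedInputsAtThree` (support, print) · A 27200
`Gss2RankOneMcCallumCertificateAtThreeTower` (crux r202, LOAD-BEARING: one McCallum certificate of
adjusted BSD depth per 3-adic-tower row = the 257 ρ̄₃-onto classes; T1⁻ at an additive 3; DATA,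
trib-w g16 HEEGNER-INDEX CENSUS `Cruxes/RamifiedPairLowerBound/A-INDEX-CENSUS.md` c00df6005811: the
∃-body is WITNESSED with n = 1, M = M₀ = ord₃∏c(E) at the TU₁ unit field on 248/257 tower rows (and
its 3Nn analogue on 98/98 NT rows) by the EXACT Heegner multiplier (NUMBERS); NO n = 1 witness at
the 9 intrinsic tower rows — there 2M₀ = B + 2, the index carries Ш(E)[3] as BSD predicts, so a
derived class n > 1 (a Kolyvagin prime, JLS method) is needed, while L₁ itself holds there in kernel
by 3-descent (`l1_at_…`)) · NT 27201 `Gss2LowerAtThreeRankOneNonTower` (crux r203, RESIDUAL OF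
RECORD on the 98 ρ̄₃ = C_ns⁺(3) classes — D-0170(1) residual flag gen 0 since 2026-08-31T02:11:42Z,
the depth-2 decl accepted by the gate; kernel-reduced — not booked — to STRUCT(print,
`MatarNekovar2019.thm07_…_of_irreducible`) ∧ A₃ₙₙ (certificates at odd split frames) ∧ U₀ by
p625317; the true obstruction there is MEMBER SEPARATION, pair control only) · glue 27202 ✓
(p620966).
#3 LeafRankOneUpperAtThree (crux, 26022; text = X2 skeleton v4 `stub_leafRankOneUpper` verbatim) —
same hypotheses, r_an(E) = 1, conclusion ord₃ #Ш(E) ≤ ord₃ q (`Typed.MissingUpperBoundAt E 3`). Road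
(rhp-p2 g2): the split-field Kolyvagin socket `IndexUpperBoundLeAt E 3 K′ P (v₃ c)` for a Heegner
point P over a SPLIT K′ plus the LOWER half of the rank-0 Gss2 twist E^{D_{K′}} (item 26023 applied
to the partner; p606327 §2) — PRINT on the 9 Tamagawa-free classes (McCallum 1991 §1,
MatarNekovar2019 Thm 0.7; ρ̄₃ irreducible is automatic on Gss2); on the other 346 classes the
research input is Tamagawa-exact global divisibility of derived Heegner classes at an additive 3
(Jetchev 2008 Σ-form, `AdditiveThree.RKC3Divisibility`-shape; tower form p607034, irreducible form
p607279). [difficulty: XL] (why it might fail: Kolyvagin's bound at 3 is Tamagawa-exact only through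
2·ord₃ ∏ c_ℓ(E); on 346/355 classes some c_ℓ is divisible by 3 and the divisibility at an ADDITIVE 3
is unproved.) [Jetchev2008, Kolyvagin1990, MatarNekovar2019, McCallumLMS1991, GrossZagier1986,
CaiShuTian2014]
  FAMILY of #3 (SPLIT gen 1, rev 11, line splitkolyvagin of rhp-p2): PUB⁺ 27491
`LeafRankOnePrintedInputsAtThree` (support, print incl. Mazur/Abbes–Ullmo/Česnavičius Manin facts;
closed conjuncts item-stated by name as asides) · S2 27492 `JetchevDivisibilityReadingS2` (ASIDE
since rev 16 — S2 EXIT, rhp-p2 g8: every composition of record takes a Heegner field with 2 SPLIT,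
where the reading is PRINT modulo F1 `GrossLMS1991.prop37_2_frobeniusCongruence` / F3 (p638868 §3,
any-carrier p643642); consumed by nothing) · Σ★″ 27493
`LeafSigmaStarDivisibilityAtThreeOptimalOffRows` (crux r303, RESEARCH, orientation-free:
Tamagawa-exact 3-divisibility of derived Heegner points on the leaf at a lattice-optimal datum off
the mono-carrier rows; CONTENT OF RECORD (rev 35) = the residue♭ stubs of the REGISTERED U-lines,
each ⟸ this item by name (top layer p743965/p744610; habitat socket p764474): on U₁
`Partnerdescent.stub_leafSigmaStarTopLayerOnWildAtlas` (line partnerdescent v14 189d0b4b71b1a57e,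
REGISTERED 2026-08-31T11:52:23Z by LEAD rhp-p2 g67, tree
`Cruxes/LeafRankOneUpperAtThree/Lines/partnerdescent.lean` commit 4b2836eb438b; lineage v2 (g55, the
PICK) → v7 (g60) → v14 (g63–g67: (G3♭ˢ) itself derived — THE CUT below), every step MONOTONE,
count-neutral, crux BY NAME; FIVE stubs PUB⁺-Manin 27491 · printFactsAll (16 cite-only Literature
names: ten incl. P3m `shimuraCurve_heegnerSystem_genusThree` p789293, the four Takahashi 2001 /
Pasten–Shimura 2024 coordinate facts, DICT♭ p820894, M1 p821944) · NUM♮ 32276 · L₀ 26023 · residue♭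
— EVERY stub an ITEM or a cite-only NAME; kernel rc 0; offhabitat v3 e9a78cefa702212d (tree
`…/Lines/offhabitat.lean`) is the FALLBACK, byte-for-byte plus the orphan-pair CUT below) = Σ★⁸ (Σ★⁷
∧ «∀ q ∣ N, v₃c_q < s′», the TOP LAYER) OFF the merged Cartan/saving habitat HabSC — on HabSC the
Cartan road U₁ ⟸ PRINT ∧ NUM♮ ∧ KERNEL is DERIVED, no stub (budget-set core p767743; p770411
`leafRankOneUpperAtThree_of_cartanItems`; (IMAGE) p774386
`LeafModThreeImage.surjThree_of_additiveCarrier` and (ATLAS) p774819 PROVED) — and restricted to the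
atlas regions R1 (two split-multiplicative Tamagawa-3 carriers t₁, t₂ ≡ 1 (mod 3), ρ̄₃ unramified at
both: the (DEG)-ORPHAN pairs) ∨ R2 (wild 2-carrier: 2³ ∣ N ∧ 3 ∣ c₂). R2 = ∅ for every E/ℚ — TREE
THEOREM p777538 ✓ `LeafNotWildTwoCarrier.not_eight_dvd_and_three_dvd_localTamagawaNumber_two` (LEAD
g55 from cruxidea-26022-2 g7's node `tameatlas`: 3 ∣ c₂ forces Kodaira IV/IV* at 2
(`CartanPlaceTwistLaw.kodairaSymbolAt_IV_or_IVstar_of_additive_of_three_dvd`), and IV/IV* at 2 is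
TAME; the residue stub's atlas hypothesis is `TwoMultCarriers W` since v3) AND off the flat
orphan-pair habitat OrphanPairFlat (v5–v7: a pair {q, r} of odd split-multiplicative carriers with
(−3/·) = 1 on which #W(ℚ_q)[3] ≠ 9, très-ramifié off the pair) ⇒ the residue♭ of record is R1 ∖
OrphanPairFlat = the doubly-scalar orphan pairs ∪ the |S| ≥ 4 configurations ∪ the R1 rows the
partner road never serves (an odd number of ≡ 1 (mod 3) carriers with no spare, or two
multiplicative + one additive carrier); its KNOWN FINITE SUPPORT is EMPTY on the leaf side on
Cremona N < 5·10⁵ (0 of the 238 multi-carrier r1 rows lie off HabSC; HabNs alone holds on 33/33 Σ★⁷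
rows) and, on the partner side, the doubly-scalar / |S| ≥ 4 complement is census-EMPTY for N_V ≤ 55
555 (3 doubly-scalar configurations below 5·10⁵: 279097a1, 424501b1, 424501c1; LEAD-G57-G3-LEDGER.md
d99a0229445c); class-wide it is not known empty. On U₀:
`SplitKolyvaginZero.stub_leafSigmaStarTopLayerOffHabitatZeroJ` (splitkolyvagin0 v27
3e98c0bf76c5e1c7, REGISTERED 2026-08-31T11:54:35Z, LEAD g67, tree
`Cruxes/LeafRankZeroUpperAtThree/Lines/splitkolyvagin0.lean` commit 0ae7b591428b, lineage under #5;
FIVE stubs PRINT₀ · residue♭ · L₁ 26021 · L₀ 26023 · NUM♮ 32276) = Σ★⁸₀ off HabJ0 := HabNs ∨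
OrphanPairFlat. LEAD PICK (rhp-p2 g55, `Cruxes/LeafRankOneUpperAtThree/PICKED.md` @e8c94e628d92 +
addenda through d980525bbfa2 (g61)) over the 13 crux-idea cards filed on 26022 by
cruxidea-26022-1/ -2, rounds 1–2 (listed in PICKED.md; incl. psjointram, tameatlas, cokernelpays and
the splitkolyvagin baseline): partnerdescent (registered; v2 then, v14 now) > offhabitat (v3,
fallback) > nscartan (v16.4 57a0969418e48781, the S = ∅ slice) > heegnerpairss > definitesum >
tamecubic > unitswitch > tamfreelower > katoprhalf; cokernelpays (seat 1 g7, node unregistered) PAYS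
the Ribet–Takahashi cokernel exponent e on E by a ONE-place Jetchev argument — complementary to
partnerdescent, which makes e vanish on the partner. THE CUT (partnerdescent over offhabitat v3;
habitat `OrphanPair` at v2–v4, `OrphanPairFlat` since v5): on the orphan-pair habitat (SHAPE ∧ an
even set S of odd split-multiplicative ℓ with (−3/ℓ) = 1 ∧ très-ramifié off it; since v5 S = {q, r}
with #W(ℚ_q)[3] ≠ 9) ROAD-R1 is a THEOREM OF THE TREE through the 3-GOOD twist partner V = E ⊗ χ₋₃
(partner kernel p776174 `LeafPartnerRT`, the Ribet–Takahashi telescope exact at 3 from cokernel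
3-freeness — a fourth (DEG) mechanism; p776209/p776367 GZ-shapes; p776667/p776842 pairing cores;
p776887 UNCONDITIONAL: W ⊗ χ₋₃ is good at 3 on the leaf; roads p777064 / p776949 rank zero; flat and
flat-split forms parts 11–13 p783058/p783155 and 11ˢ–13ˢ p797389 + `…LeafPartnerRoadR1FlatSplit`)
from print and ONE research input since discharged into items + print: (G3)
`PartnerCokernelThreeFree` = ITEM 27595 (kind ASIDE r305 since rev 34, FAMILY entry below: Pasten's
component-order package + the fifth property «3 ∤ j_p(D,M) at p ∣ D», class-wide RESEARCH — print's
Ribet–Takahashi 3-exactness needs ρ̄_{V,3} ramified at a prime of D or at two primes ∥ M, false on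
every proper orphan row; CONSISTENT by instrument at 9709d1 / 424501b1; CHEAPEST FALSIFIER (a)) was
consumed by the lines (v5–v7 / v18–v20) only through the weaker (G3♭ˢ)
`PartnerCokernelThreeFreeFlatSplit` ⟸ 27595 — cokernel 3-freeness at r on a PAIR level D = qr, q
SPLIT multiplicative, #V(ℚ_q)[3] ≠ 9, the range of the LEAD's pen-AGREED non-scalar derivation from
print (LEAD-G56-G3-NONSCALAR c74bd2e2e6f1) — and LEAD g61–g67 (2026-08-31; 43 helper files
`--supports 26022`, 0 sorry, p-ids in NUMBERS; memos LEAD-G61-G3-CORE v4 · G62-FPE · G63-ASSEMBLY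
2bb48c482fdb6216 · G64-BASECHANGE 7410139a24fac433 · G65-HECKETWIST 9af9d6b5f07ef8ee ·
G66-DICTSTABLE e4f76333d864a543 · G67-DICTPRINT 8a7a7c4871e3496a) made (G3♭ˢ) a THEOREM of the
route's items + cite-only print, NO LONGER A STUB: g61/g62 the algebra ((F6), Gorenstein core,
cokernel valuation, exact Eisenstein, FPE ⇒ (C4) Gross-pairing perfectness on ℤ[Cls O]⁰ at every
non-Eisenstein 𝔪, residue char. 3 included); g63 the congruence-lattice theorem
`LeafPartnerOrders.smul_sub_mem_annihilator_iff_forall_smul_mem` (p810424: the congruence ideal of f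
in the qr-new algebra EQUALS the denominator ideal of e_f on Ribet's lattice Y — Papikian–Rabinoff's
s = r with no geometry left; over ℤ₃, local factors p810777) ⇒ (G3♭ˢ) ⟸ PRINT-COORD (the four
Takahashi 2001 / Pasten–Shimura 2024 coordinate facts) ∧ (G3♭ᶜ) `CokernelFifthInCoordinatesAtThree`
(p810935), CUTTING Step 2 (Ribet's degeneracy sequence (C2) is NOT needed); g64 (α) base change over
ℤ₃ (p814177/p814294) ⇒ (G3♭ᶜ) ⟸ (HT) the Hecke–Atkin–Lehner twist ∧ (DICT) the Ribet–Takahashi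
character-group dictionary ∧ (M1) multiplicity one at a non-scalar Frob_d; g65 PROVES (HT)
(`LeafPartnerOrders.leafHeckeTwistAtThree` p817968: the Gross-adjoint of U_ℓ is its Atkin–Lehner
conjugate); g66 shrinks DICT to DICT♭ (Hecke stability from the projector p819076; rank one of the
eigenline from `takahashi2001_thm_2_3_shimura_disc.xi_pos` p819594); g67 TYPES DICT♭ and M1 as NAMED
Literature FACTS —
`Literature.NumberTheory.Automorphic.shimuraCurve_characterGroupHeckeDictionary_disc` (p820894,
reviewed «faithfulness checked at the page»; Takahashi 2001 §2–3 [corpus: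
paper:doi-10-1006-jnth-2000-2614 p.78–84], Helm 2007 Thm 5.4 / Cor 5.3 [corpus:
paper:arxiv-math_0401265 p.14], Papikian–Rabinoff 2016 ¶23–25 [corpus: paper:arxiv-1212.3574], Ribet
1990 Thm 4.1 through the held sources (acq-09883); arbitrary cofactor covered; residual risk in the
docstring = the orientation of the tree's U_ℓ) and `…ribet1990_characterGroup_multiplicityOne`
(p821944, print-by-composition DDT 1995 Thm 4.26(a) `wiles1995_multiplicityOne` ∘ Edixhoven 1997
§3.2–3.3 [corpus: book:cornell1997-modular-forms-fermats-last-theorem p.230–236]: toric 𝔪-torsion at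
a non-scalar Frob_d of dimension ≤ 1 in residue characteristic ≥ 3; the pen's C-check
PEN-G28-C3-HELM v2 94aedcb505465d07 agrees — Helm's own Lemma 6.5 / Prop 5.6–5.7 EXCLUDE
characteristic 3, so ℓ = 3 rests on Edixhoven/DDT and Takahashi 2009, acq-14935, is no longer an
input); (DISPLAY) `PartnerGenusDisplayAtThree` → (DISPLAY-L) `PartnerGenusDisplayLabelledAtThree` is
DERIVED modulo print (p795531 `…LeafPartnerGenusDisplayLabelled` over partner-kernel parts 14–22,
LEAD g58/g59; its one print input P3m p789293 is the tenth conjunct of printFacts) and is no longer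
a stub; residue♭ (RESIDUE-W♭) = Σ★⁸|(TwoMultCarriers ∧ ¬HabSC ∧ ¬OrphanPairFlat) ⟸ 27493 — NET (LEAD
g67 FINAL): U₁ ⟸ {27491 PUB⁺, 32276 NUM♮, 26023 L₀, residue♭ ⟸ 27493} ∧ the 16 cite-only names; U₀ ⟸
{residue♭ ⟸ 27493, 26021 L₁, 26023 L₀, 32276} ∧ PRINT₀ — every stub an ITEM or a cite-only NAME,
nothing tree-side left on the orphan-pair road; (G3) 27595 is consumed by NO stub (LEAD g68: «not
load-bearing») ⇒ kind ASIDE since rev 34 ((816)/(823)(a); a kind flip, NOT progress); LEAD rhp-p2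
SUMMON-ONLY (director (828)): re-armed only on movement on 27491/32276/26023/27493/26021, a
Disproof/Negative on 26022/26024, a `_holds` for one of the 16 names, or a pen SUMMON. HISTORY OF
THE CUT (rhp-p2 g9–g15: Σ★⁷ v14 711c4f14b593f21d → Σ★⁸ v15 652846695ca80a5f → nscartan → offhabitat;
memos SHIMURA-INERT-g10, SAVING-ROAD-g11): the mono-carrier rows, the PAIRING-SHIMURA rows (carriers
INERT in a Jetchev–Skinner–Wan field, Ribet–Takahashi degree drop: U₁ ⟸ printed Shimura-curve facts
∧ L₀, NO Σ — p650686 … p658146, pairing core p664351/p664781) and the SAVING rows (one Tamagawa-3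
carrier on N⁺ paid by the saved split display: p668428/p669432, discharged p673852 modulo the ONE
cite-only input PRIM₃ `…shimuraCurve_heegnerSystem_primitivesAtThree`, INPUTS T31; R6–R8
p677195/p678841/p679042 — no JSW-flagged fact is an input of U₁/U₀) left the residue first and now
sit inside HabSC; on U₀ the same exits ⟸ printed facts incl. Friedberg–Hoffstein simple-zero
inert/split (FH_sq₂ forms p768129 / p773715 typed) ∧ L₁ (∧ L₀ on saving rows): p659140 … p671861,
KERNEL₀ p775104, supply p775149 — acyclic: no registered line of L₁ or L₀ consumes a U-member;
chains Σ★″ ⟹ … ⟹ Σ★⁷ / Σ★⁷₀ by name (p645042 … p671861) and Σ★‴ ∧ F1–F3 ∧ Manin ⟹ Σ★″|₂ (p646369);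
residues of record (Cremona < 5·10⁵) r1 Σ★⁷ = 33 of 238 multi-carrier classes (17 lonely pairs q_a +
q_m with no third multiplicative prime + 16 two-additive-carrier rows; 123 pairing-Shimura and 82
saving rows exit), r0 Σ★⁷₀ = 14 of 103 (8 + 4 + 2; 59 pairing-Shimura and 30 saving rows exit).
BARRIER READING OF THE RESIDUE (rhp-p2 g12–g14): residue = exactly the rows with ≥ 2 Jetchev
(stringent Tamagawa-3) places; within a class the tree's Jetchev engine
(`JET.Section6.tamagawaExponent_le_m_of_selmerFamilies`) certifies 3^{max tᵢ}, never 3^{Σ tᵢ} =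
`Literature.Barriers.BirchSwinnertonDyer.StringentKolyvaginCapsAtMax` verbatim, and no reshape of
Σ★⁷ inside the line evades it. Evasions: (ii) «N⁻-saving of a carrier» is CLOSED at every additive
carrier by local type (LEAD-G14-DATUM 7b31a4b91cb2004f: a IV/IV* carrier q ≠ 3, q = 2 included, has
ρ_{E,3^∞}(I_q) ≅ ℤ/3, f_q = 2; PS carriers admit no Jacquet–Langlands transfer, SC carriers have
Saito–Tunnell sign +1 for K inert; the 6 lonely rows with an odd-exponent even set {q_m, 2} have no
`IsAdmissibleFactorization`); (iii) «congruence to a Steinberg form» reaches Sel₃(E) only, never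
#Ш[3^∞] (LEAD-G13-DATUM 5f8f753eb9f2c686: E[9]^{I_q} ≅ ℤ/3, the congruence is mod 3 only); (i) an
Iwasawa main identity with Tamagawa-LENGTH control at the additive potentially supersingular 3
(signed anticyclotomic ⊇ + control for E/K at the ramified good-supersingular 𝔭 ∣ 3) is the ONE road
standing — not in print (Σ-form Kolyvagin only at good ordinary p > 3: BCGS Camb. J. Math. 14 (2026)
Thm 2, arXiv:2601.14504 Thm 3; arXiv:2410.23241 pot. good ordinary reducible; galaxy 0 hits). LAYER
READING (pen g23, memo `RECUT-WORD-pss3g23.md` f076b19cbb71d318): the layers s′ ≤ m := max_q v₃c_q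
of Σ★″/Σ★⁷ are the TREE theorem R (any-carrier Jetchev reading
`JetchevReadingAnyCarrier.rowDivisibilityAnyCarrier_of_namedFacts` /
`anyCarrierTwoSplitReading_of_namedFacts`, rhp-p2 g9, modulo F1 ∧ F3 ∧ PT — the line's own FACTS″);
the CONTENT is the layers above m = the complement of `StringentKolyvaginCapsAtMax` exactly — on
each of the 33 Σ★⁷ rows ONE layer, the top one s′ = Σtᵢ (= 2 on the 16 two-additive rows and the t_m
= 1 pairs), Jetchev Conj. 1.3 beyond Thm. 1.4; (the Σ★⁸ case split is made INSIDE the 2-split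
Friedberg–Hoffstein composition `LeafShimuraInert.pdiv_three_of_anyCarrierReading_of_topLayer`,
rhp-p2 g15, SUMMON 715ed81f4c818b4c; as bare ∀-statements «Σ★⁷ ⟸ Σ★⁸ ∧ R|₂» is frame-level shorthand
only — a 2-inert field would need R's «2 Kolyvagin ⇒ ρ̄₃ onto» guard) By p626741 Σ★″ ⟺ U₁ ∧ U₀
modulo {PUB⁺, S2, L₁, L₀, MN §0.11} on the whole leaf — no surplus over BSD₃, and any certificate
refuting it refutes BSD₃ on the leaf; DISPROOF OF RECORD (cdisprove-27493,
`Cruxes/LeafSigmaStarDivisibilityAtThreeOptimalOffRows/Disproof.lean` @cdff72e561df — NO kill;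
landed under `Theorems/LeafSigmaStarDivisibilityAtThreeOptimalOffRows/Negative/`): the budget clause
s′ ≤ B is LOAD-BEARING (`leafSigmaStar_false_without_budget`, p766049); at n = 1 PDiv ⟺ s′ ≤
ord₃[E(K):ℤP] (McCallum 5.1 threshold `pDiv_one_iff_le_padicValNat_index`, p768463; irreducible-row
form p768620), so Σ★″ ⟹ B ≤ ord₃[E(K):ℤP] and «budget + 1» is FALSE at n = 1 modulo the per-row
index hypothesis ord₃[E(K):ℤP] ≤ B (⇐ BSD₃(E) ∧ BSD₃(E^{d_K}) ∧ 3 ∤ #Ш(E/K)) — ROW-WISE SHARP modulo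
BSD₃-pair ∧ GrossLMS Cor. 5.6 (`budget_succ_false_at_row_of_bsdp_pair_of_h56`); the census clauses
Odd / optimal / off-rows / Addv / SubGss / ¬CM are not load-bearing for truth; the (500) probe
(CHEAPEST FALSIFIER) finds B ATTAINED at n = 1 on 4/4 ρ̄₃-onto rows — Σ★″ is typed at the edge, as
BSD₃ predicts) · glue G₁ 27494 (member-conditional by design: G₁ ⟸ L₀ by p626516, OR G₁ ⟸ TU₁ by
p630223 — TU₁ := ∀ non-CM rank-one leaf W, `SchneiderFree.Upper.TwistUnitFieldAt W 3`, the
TWIST-UNIT ROAD of rhp-p2 g7 (memo TWIST-UNIT-ROAD-g7.md): research at an additive 3 (Ono–Skinner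
all-but-finitely-many p; Prasanna / Burungale–Hida–Tian arXiv:1712.02148 Thm 1.5 need p ∤ N; Kriz–Li
needs E[p] reducible), SURPLUS over the leaf, per class an exact finite certificate (NUMBERS); U₁'s
ALTERNATIVE glue, deliberately NOT an item — pen decision (a), 2026-08-28) · NUM_leaf 32139
`LeafCartanOnePlaceDegreeLawAtThree` (kind ASIDE r302 since rev 34 — flipped by the cone pass the
rev-34 render re-ran; director (823)(b): ACCEPTED, NO restore — by-name consequence of 32276, named
by no registered stub, not a binder; born rev 25 from nscartan v16.3's stub, LEAD g53: the
24801-type ONE-PLACE degree law at a non-split Cartan place, read on the leaf) and NUM♮ 32276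
`CartanOnePlaceDegreeLawAtThreeNatural` (crux r302, rev 26, BY NAME: statement = the
route-independent constant `Theorems.CartanCorrespondence.CartanOnePlaceDegreeLawAtThreeNatural`,
director (528)/(532)(b); ONE crux shared with ClassRecordThree r4 and KolyvaginRoadThree r4; both
stamped checked_at 14:25:08Z): 32139 ⟸ 32276 (`leafCartanOnePlaceDegreeLawAtThree_of_natural`,
p768893) and is COUNTED UNDER 32276; 24801 ⟸ 32276
(`CartanNaturalChain.classRecordThree_cartanOnePlaceDegreeLawAtThree_of_naturalItem`, p771614 ✓);
32276 ⟸ (ISO)♮ `CartanCover.CMRank.CoverIsotypicComponentNatural` ∧ DS 6.1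
`DeligneSerre1974.thm61_exists_adicGaloisRep` ∧ (JLᶜ) `jacquetLanglands_cartanCover_newform`
(p770242/p771422); director (552)(B)/(558)(B) 2026-08-30: (ISO)♮ — the L1 device
`CoverIsotypicComponent` — AUDITED a FAITHFUL SPECIAL CASE OF PRINT (INPUTS-1 23098e14d38c78de; LEAD
tam3-p1 concurring) ⇒ LABEL OF RECORD «32276 / 24801 / 32139 closed modulo {(ISO)♮ print†, DS 6.1
print, (JLᶜ) print}» — typed ≠ proved: both stay OPEN until a `_holds` lands; 32276 is in U₁'s/U₀'s
cone through the registered stub `stub_cartanOnePlaceDegreeLawNatural` of v14/v27 (the gate's cone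
pass is skeleton-blind on 32276 — the stub names the THEOREMS constant, the item is the Theses decl
— and has flipped it crux → aside three times (last rev 28), RESTORED each time by `--retriage` per
director (592)/(593)(A)/(603) (last rev 29); the rev-34 pass put it in `grace`, kind still crux —
(823) STANDING: if a later render flips it, restore ONCE; 32139's flip stays; (593)(B): not a count
move) · (G3) 27595 `PartnerCokernelThreeFree` (kind ASIDE r305 since rev 34 — pen g28's kinds-only
`--retriage` under director (816) YES + LEAD g68's word «not load-bearing for U₁/U₀; lineage does
not object», CONFIRMED (823)(a); item NEW at rev 28 — director (630)(a) on LEAD g56's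
`promote-stub`; signature 6609f064cceff022 (1 046 ch) = partnerdescent v4.2's `def
PartnerCokernelThreeFree` VERBATIM (∃ cI cJ : ComponentOrderFun, the four printed properties ∧ «¬ 3
∣ cJ P p at p ∣ D for a class-minimal P of V, Irr V 3, 3 ∤ N_V»); why-might-fail = Ribet's
multiplicity-two regime for J^{qr}_0(M)[𝔪] on the proper orphan rows; 7 sources; `#h21_crux_probe`
CLEAN; checked_at 17:49:03Z 08-30; ledger depth 0; evidence: pen second read 22fd0a18accce2bf + LEAD
memos G56-AUDIT · G56-G3-NONSCALAR · G57-G3-LEDGER · G60-G3FLAT-SPLIT · G61–G67; since g63–g67 NO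
registered line consumes (G3) or its flat / coordinate weakenings as a stub (THE CUT), so 27595 is
the STRONGER class-wide research sibling of record: in the file, wanted_by RHP kept, `cone.unused`
since 17:45:48Z 08-30, never re-worded, never staffed, its «3c G3-LEDGER» readings INSTRUMENT words
on its evidence ((630)(b)/(649)); a refutation AS TYPED ⇒ KILL CRITERIA (drop alone)). U₀ 26024
carries Σ★⁸₀ (⟸ this Σ★″ item by name) in its registered line (splitkolyvagin0 v27 3e98c0bf76c5e1c7)
and is not split (single parent per route); COUPLING RULE: on the 3Nn rows the route books the
U-side direction U₀ ⟸ … ∧ L₁ (∧ L₀ on the saving rows) and keeps NT residual — never both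
directions; L₀'s certificate road through U₁ (p630495/p631233: L₀ ⟸ print ∧ A₀ ∧ U₁) and G₁'s closer
through L₀ are never BOTH glued; modulo the rank-zero twist-unit supply TU₀ (p631701: U₀ ⟸ PUB₀⁺ ∧
S2 ∧ Σ★″ ∧ TU₀; p633230 the 3Nn form) the coupling is OPTIONAL and NT's supply circle-free (NT ⟸
STRUCT ∧ A₃ₙₙ ∧ S2 ∧ Σ★″ ∧ TU₀|3Nn). PEN STATE B0 (2026-08-28, both leads concurring): U₀ keeps NO
family; TU₀/TU₁ are ROADS (`--supports` 26024/26022), not items; the pre-staged B1 split of U₀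
(PUB₀⁺ · TU₀, closer one line from p631701) fires only on a director ruling.
#4 Gss2LowerAtThreeRankZero (crux, 26023, DECLARED RESIDUAL — no seat of this route attacks it;
D-0170(1) residual flag gen 0 since 2026-08-31T02:11:37Z; consumed BY NAME as stub L₀ of both
registered U-lines; text = X1 v3 `stub_gssLowerAtThree_rankZero` verbatim) — r_an(E) = 0,
`Typed.MissingLowerBoundAt E 3`. It is needed TWICE: by `closes` at r = 0 and inside U₁'s
split-field road (for the rank-0 twist partner). Road: Kato's main conjecture 12.10 for (f_E, 3) at
an additive 3 made index-exact — announced by Fouquet–Wan (arXiv:2107.13726 Thm 5.1 / Cor 5.4, PRE)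
on the FW locus (a non-split multiplicative ℓ ≠ 3 with 3 ∤ v_ℓ(Δ)); the cell's KMC₃ ⇒ lower-half
descent exists (`TorsionFree.missingPPartAt_rankZero_of_kmc`, ClassO5 frame; Manin at I₀* is a
theorem). [difficulty: open-problem] (why it might fail: Kato's divisibility at an additive 3 is an
inclusion after ⊗ℚ_p or up to the image index; an index-exact ⊇ at p = 3 additive potentially
supersingular is in print for no class.) [Kato2004Asterisque, FouquetWan2021,
Fouquet2025EquivariantTNC, SkinnerUrban2014]
#5 LeafRankZeroUpperAtThree (crux, 26024; `tribunal_fit` residual since rev 5 but NOT flagged under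
D-0170(1) — director (736) 2026-08-31: its registered skeleton splitkolyvagin0 (v20 then, v27 now)
reduces it to the route's items + print, so it is worked through them; text = X2 v4
`stub_leafRankZeroUpper` verbatim) — r_an(E) = 0, `Typed.MissingUpperBoundAt E 3`. PRINT on the
Kato-sharp rows (3-adic tower image onto ∧ 3 ∤ ∏ c_ℓ ∧ 3 ∤ c_D:
`leafRankZeroUpper_three_of_kato_on_sharp_rows`, p606731); open off those rows. Roads (rhp-p2, line
splitkolyvagin0): the registered split-field Kolyvagin cut (skeleton of record splitkolyvagin0 v27
3e98c0bf76c5e1c7, LEAD g67 2026-08-31T11:54:35Z, commit 0ae7b591428b; FIVE stubs PRINT₀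
`stub_printedInputsZeroAll` · residue♭ `stub_leafSigmaStarTopLayerOffHabitatZeroJ` = Σ★⁸₀ off HabJ0
:= HabNs ∨ OrphanPairFlat (⟸ 27493) · L₁ 26021 · L₀ 26023 · NUM♮ 32276 — (DISPLAY-L), (G3♭ˢ)/(G3♭ᶜ),
(HT), (DICT♭), (M1) derived / proved / cite-only, not stubs; road BY CASES — Cartan road (KERNEL₀
p775104, supply p775149) ∣ partner road (p776842, ROAD-R1₀ p776949; flat-split form g60); lineage
v13 → v16 (g55) → v20 (g60) → v27 (g63–g67), the mirror of U₁'s chain (THE CUT under #3) — consumes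
the deciding member at the rank-one twist and L₀ on the saving rows) and the twist-unit cut (PUB₀⁺ ∧
S2 ∧ Σ★″ ∧ TU₀, p631701 — consumes neither member); rhp-p1 g6: U₀ ⟸ Kato A161″ ∧ GZK ∧ modularity ∧
U₀|3Nn and conversely (p630156) — U₀'s research content is exactly its ρ̄₃-not-onto rows.
[difficulty: L] (why it might fail: Kato 2004 Thm 17.4 at an additive 3 bounds #Sel only up to the
Tamagawa/torsion index and needs large tower image; off the sharp rows — 284 onto-but-Tamagawa + 53
normaliser-image classes of 705 — no upper bound at 3 is in print.) [Kato2004Asterisque,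
MatarNekovar2019, Miller2011LMS]
#9 PublishedInputGZK (support, 19921, shared) — Gross–Zagier–Kolyvagin: rank = analytic rank and Ш
finite for analytic rank ≤ 1 (tree named fact `rank_eq_analyticRank_of_analyticRank_le_one`); the
ONLY displayed PUB hypothesis of `closes`; never counted as progress. [difficulty: provable-now]
[GrossZagier1986, Kolyvagin1990]
ASIDES (banked context, never reworded, never staffed): 23191 RamifiedPairLowerBound (X1) and 23192
RamifiedPairUpperBound (X2) — superseded by the members (equivalences above); their skeletons v3 /
v4, memos, the two certified rung pairs and helper files stay as evidence and as L₁'s / U₁'s line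
material; 23193 GoodSupersingularAtThree — no longer load-bearing; 23194 RamifiedTwistSupply and
25112 PublishedInputTwists (children 25006/19449/19382/25143 are shared displayed-PUB supports typed
by the inputs mint, 25144 glue closed) with 25113 RamifiedTwistSupplyOfPub (closed·proved) — the
supply is used only inside L₁'s line now.

TWO-LAYER PLAN. Foreseen glued splits below the members (at most one layer; the families of #2/#3
are the ones filed): for L₁ over the 3-ramified K — `LowerHalfOverKRamified` (lower half of
BSD₃(A/K), A = E/ℚ(√d), v₃(d) = 1, r_an(A/K) = 1; ≡ X1 modulo PUB: p598811 + p600026, pointwise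
p604713) with children RamifiedSignedColeman (signed decomposition of H¹_Iw over the anticyclotomic
ℤ₃-tower of the ramified K_𝔭) → RamifiedReciprocity (CM-point Λ-adic class ↦ Kriz's anticyclotomic
L-function) → RamifiedIMCDivisibility (Howard's Kolyvagin-system divisibility + rank-one BDP-type
conversion); alternatively the ℚ-side `PAdicGZOmegaBranchAtThree → Gss2LowerAtThreeRankOne`. For U₁:
`TamagawaExactDivisibilityAtThree → Gss2LowerAtThreeRankZero → LeafRankOneUpperAtThree` (the
split-field socket of p606327 §2 as a glue; first child = Σ★″ 27493's content, second = item 26023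
itself).

KILL CRITERIA. A refutation of any member as typed (a Gss2 curve with ord₃ #Ш(E)_an ≠ ord₃ #Ш(E),
i.e. a counterexample to BSD₃ on the leaf — e.g. one of the 9 intrinsic rank-1 classes with Sel₃ of
rank 1 instead of 3) closes the route `refuted:<Decl>` (and refutes BSD). If the local signed theory
over a ramified quadratic base is shown impossible at p = 3 (e = p − 1 obstruction for the
anticyclotomic tower) AND no 3-adic Gross–Zagier on the ω-branch is forthcoming, L₁ keeps only the
per-class descent road and the route retires `exhausted` with the census as its record. If
Tamagawa-exact divisibility at an additive 3 fails in Jetchev's Σ-form on some class (index defect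
beyond Σ ord₃ c_ℓ), U₁'s only line dies and U₁ must be re-sourced (Kato-type upper bound in rank
one: not in print) or declared residual. A KILL of Σ★″ by INSTRUMENT (a certified non-zero depth-2
readout ψ_E(𝒟_n) ≢ 0 (mod 9) on a Σ★⁷ row under a co-signed PREREG-SIGMA-MOD9, D-0168) counts only
when reproduced by a second independent engine and after the Ihara conditional (I) of SIGMA-TEST and
the print inputs are audited — Σ★″ has no surplus over BSD₃ (p626741), so such a kill contradicts
BSD₃ modulo print; mod-3 (s′ = 1) readouts cannot kill (forced by R). The disprover's record
(Disproof.lean @cdff72e561df) fixes the SHAPE of any kill of Σ★″ as typed: the budget is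
load-bearing and sharp at n = 1 modulo BSD₃-pair ((500): attained on 4/4 probed rows), so a
refutation needs a DERIVED class P_n, n > 1, failing 3^{s′}-divisibility at a layer m < s′ ≤ B on a
residue row — by p626741 a counterexample to BSD₃ on the leaf modulo print. (G3♭ˢ) is no longer a
stub (g63–g67: a theorem of items + cite-only print), so the CUT has no `stub-false` left to suffer;
a 3 in #coker Φ_r on (G3♭ˢ)'s own range (split q, #V(ℚ_q)[3] ≠ 9) would now contradict a CITED print
fact as typed — DICT♭ p820894, M1 p821944 or a coordinate fact — i.e. re-scope a Literature citation
(INPUTS audit; fallback offhabitat v3, the residue grows back to R1), never a member. A refutation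
of ITEM 27595 (G3) AS TYPED (CHEAPEST FALSIFIER (a); (G3♭ˢ) survives, LEAD g60) counts for this
route as class `misstated` (27595 is ASIDE since rev 34, in no binder of `closes`, named by no stub,
but still wanted_by RHP, so the gate may flip the route BROKEN) and is repaired in ONE announced
call: `--drop PartnerCokernelThreeFree` ALONE (nothing to re-file — no line consumes (G3♭ˢ) as a
stub any more), `closes` and glue untouched, 27595 left in the file as the settled negative edge. If
QBSC's η-branch control is extended to p = 3 and closes item 19120 `Gss2AtThree`, this route is
mooted (`superseded --by route-BirchSwinnertonDyer-QuadraticBranchSignedControl`).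

NOT DECOMPOSED YET. The over-K objects under L₁ (signed Coleman maps over the dihedral tower, a₃(V)
= 0 vs ±3, the reciprocity law, the Manin-type constant deg f/(f,f)_U at level 9 ∣ N, the m = 1
field ℚ(√−3) ⊂ ℚ(E[3])), the per-class descent certificates (tribunal-w TURNKEY-L1-INTRINSIC9 on the
9 intrinsic classes), the certificates A₃ₙₙ on the 98 r1 classes with ρ̄₃ not onto (helpers
`--supports 27201`), the onto/3Nn row split of U₀ and any row decomposition of L₀ / U₀ (FW locus,
Kato-sharp rows) are deliberately NOT items: they are line stubs (`Cruxes/<Decl>/Lines/*.lean`,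
registered by the leads) or — for L₁ and U₁, done (rev 9 / rev 11) — layer-2 children promoted
verbatim from a registered skeleton; nothing below layer 2 becomes an item (a proved glue pins its
family's names and texts: new content below it lands as `--supports` lemmas). DERIVED — neither
items nor stubs any more (rev 35): (G3♭ˢ), (G3♭ᶜ), (HT), (DICT♭) and (M1) of partnerdescent v8–v14 /
splitkolyvagin0 v21–v27 are theorems of the route's items + the 16 cite-only names (LEAD g63–g67);
the (630)(a) promote-«item» protocol has nothing left to promote, and 27595 was re-based ASIDE at
rev 34 on the LEAD's word «not load-bearing» ((676)(2)(b)/(816)/(823)); NOTHING TREE-SIDE IS LEFT on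
the orphan-pair road — under U₁/U₀ remain ITEMS (27491 print, 32276, 26023/26021, 27493) + cite-only
PRINT; never a child of 27595 or 32276 — no third layer; equally NOT items: the derived predicates
(DISPLAY)/(DISPLAY-L) and ROAD-R1/R1♭/R1♭ˢ (tree theorems), the habitat predicates HabSC / HabNs /
HabJ / HabJ0 / OrphanPair / OrphanPairFlat / atlas, and every crux-idea node under
`Cruxes/LeafRankOneUpperAtThree/Lines/` (registration and the PICK are the LEAD's call). The by-name
NUM items 32276 (crux) / 32139 (aside since rev 34) are the recorded exception (three routes share
ONE crux). Equally NOT items: the twist-unit supplies TU₁/TU₀ (twins of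
SchneiderFreeAdditiveX3Upper's `TwistUnitX3OffSliver` 20364; roads p630223/p631701/p633230,
packaging p632827; per-class decidable — trib-w censuses, NUMBERS), the rank-zero certificates A₀,
and rhp-p1 g6's COLUMN ASSEMBLIES (p631681 v1 · p632422 v2 · p633075 v3: WAllExclAddGssAtThree ⟸ GZK
∧ PUB 27199 ∧ PUB⁺ 27491 ∧ PUB₀⁺ ∧ MN ∧ A 27200 ∧ A₃ₙₙ ∧ A₀ ∧ S2 27492 ∧ Σ★″ 27493 ∧ TU₀ ∧ TU₁ — ONE
kernel statement of the column's residual list) — an alternative decomposition of the leaf BY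
MECHANISM, by D-0019 a SEPARATE route sharing A/S2/Σ★″, not filed (same research content; A 27200
has no engine in print — rhp-p1 g6 ended `blocked-on: stmt-BirchSwinnertonDyer-27200`).

CHEAPEST FALSIFIER. SPENT, nothing refuted (kernel records or instrument words, never progress on
the leaf): (1) the 9 INTRINSIC rank-1 Gss2 classes (133956n, 169848k, 182853c, 205128l, 228897c,
250065g, 355338h, 409248cy, 439794p; #Ш_an = 9): dim_𝔽₃ Sel₃(E) = 1 instead of 3 would refute L₁ ∧
U₁ (and BSD₃) visibly — trib-w g8 (Schaefer–Stoll descent): dim Sel₃ ≥ 3 GRH-free (= 3 under GRH) on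
all 10 curves, kernel records `l1_at_<label>` in
`Theorems/RamifiedHeegnerPairL1Intrinsic{,A,B,C}.lean` (= the tribunal_fit witness); (2) the 366
intrinsic rank-0 classes: Sel₃(W) = 0 would refute L₀ visibly — trib-w-rhp g18,
PREREG-L0-SEL3-r0i-v1 ba103333491e8b7e written before data, memo
`Cruxes/RamifiedPairLowerBound/L0-SEL3-CENSUS.md` ab685cf20918: 366/366 verdict C — dim Sel₃ ≥ 2
GRH-free, (ℤ/3)² ⊆ Ш[3], incl. the 93 rows off the Fouquet–Wan locus; kernel records p741134
`Theorems/RamifiedHeegnerPairL0Intrinsic.lean` (`l0_at_…` ×4 + the Selmer-currency door, --supports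
26023); (3) SIGMA-TEST v1.4 @d3c484d6e983 (trib-w-rhp g10–g18): the mod-3 derived-Heegner readout on
the engine-visible slice of Σ★″ (255915bd1, 471735h1) — 45/45 + 53/53 calibrated readouts zero,
forced by R (s′ = 1 ≤ m): calibration, no kill power (NUMBERS); (4) D-0168 slot 3 — the DEPTH-2
(mod-9) readout for the residue's top layer s′ = 2: PREREG-SIGMA-MOD9-v1 r2.1 ef7f33fdb9a18619
(fixed before data; `brandt9`, g19) → RESULTS
`Cruxes/RamifiedPairUpperBound/RESULTS-SIGMA-MOD9-v1.md` @099d376b72c0 (evidence 27493/26022/23192):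
gates INFORMATIVE on W1 190575di1, W2 380556g1, W3 28611z1, W5 252252bo1; 21 Σ-informative pairs +
20 singles + 3 half-informative: EVERY LOAD ≡ 0 (mod 9), EVERY CONTROL 0 (21/21), positive control
37a1 NONZERO where allowed; WORD «Σ★⁸ CONSISTENT at s′ = 2 on W1, W2, W3, W5» = VALID-direction — an
INSTRUMENT reading, not a proof, and (no surplus over BSD₃, p626741) not a kill without the Ihara
conditional (I); no ANOMALY; W4 BLIND (reserve); (5) D-0168 slot 3b (director (479)) — F2 of the
card psjointram: PREREG-RHP-F2 r2 4def2afcb3f207b6 written before data (row 335727b1, K = ℚ(√−803)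
jointly ramified at the principal-series carrier) → trib-w-rhp g20, RESULTS 29c1892874e63f2d: WORD
PASS(Man) (k_U = 0, δ = 0, e_emp = −1) — (Man_U, 3) holds on 335727b1 under premise (h3); card
material `PsjointramAddendum.md` r2, ONE row, no kill power by design; (6) the (500) TIGHTNESS PROBE
(trib-w-rhp g20, TIGHTNESS-HEEG2-PROBE500.md 6aba85f856db8c17): on the four ρ̄₃-onto residual rows
142956q1 (d = −167), 252252bo1 (−887), 198900n1 (−191), 282240gd1 (−311) the EXACT Heegner index has
ord₃[E(K):ℤy_K] = 2 = T_ℚ = T_K/2 — Σ★″'s budget B ATTAINED at n = 1 (the disprover's §3c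
sharpness). The (479) crux-ideate rounds on 26022 (13 cards + PICK) and the cdisprove seat on 27493
(Disproof.lean + three Negative lemmas) are DONE, NO kill. NEXT CHEAPEST now (LEAD g55–g60
disprover-wanted lists; instrument readings are words on evidence, never item verdicts): (a) ITEM
27595 (G3) AS TYPED at a NON-split scalar(−1) pair (q ≡ 1 (3) non-split multiplicative, 3 ∣ ord_q Δ,
unit part of Δ a cube mod q): ONE Brandt-module component-group cokernel #coker Φ_r with a 3 in it
refutes 27595 as typed (misstated for this route — 27595 is ASIDE since rev 34, consumed by no stub;
KILL CRITERIA: drop alone). The (630)(b)/(649) INSTRUMENT «3c G3-LEDGER» exists (LEAD g57,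
LEAD-G57-G3-LEDGER.md d99a0229445c; ecdata census N_V < 5·10⁵: 252 orphan-pair configurations (V; q,
r) with N_V square-free, 3 ∤ N_V, ρ̄₃ irreducible, q ≠ r ≡ 1 (3) split, 3 ∣ c_q, c_r — 186
non-scalar at both, 63 at one, 3 DOUBLY-SCALAR 279097a1 · 424501b1 · 424501c1, |S| ≥ 4 EMPTY in
range) and its readings so far are CONSISTENT with (G3): control 9709d1 (j₇ = j₁₉ = 1; RT EXACT
9504/1056 = 9 = c₇c₁₉) and the doubly-scalar LEAF instance 424501b1 (j₇ = j₃₇ = 1; RT EXACT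
2239488/82944 = 27 = c₇c₃₇; exact readings in 27595's informal); 279097a1, 424501c1 and the direct p
= 37 reading are UNREAD; (b) (G3♭ˢ) on its own range (split q, #V(ℚ_q)[3] ≠ 9) is since g63–g67 a
THEOREM of items + named print: a 3 in #coker Φ_r there would re-scope a CITED fact (DICT♭ / M1 / a
coordinate fact) at the page — a citation audit, not a stub kill — the 186 + 63 non-scalar
configurations are its instances; (c) (DISPLAY-L) is DERIVED, so the 3-adic constant √(c²) = 3
against covol(Λ_V) = 3·covol(Λ_E) is an audit of the P3m citation
`shimuraCurve_heegnerSystem_genusThree` (print†), not of a stub; the residue R1's leaf-side finite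
support stays EMPTY on Cremona N < 5·10⁵ (partner-side rows sit at leaf conductor 9·N_V, beyond the
W-census) and a Σ★⁸|R1 mod-9 run (PREREG-SIGMA-MOD9 v2, reserve W4) waits for an engine-visible leaf
row; (d) for the ROADS: a leaf class with NO 3-unit Heegner twist — 457470bj1 is the one open row of
the window (NUMBERS). Lever sanity (minutes, LMFDB): the minimal model of E^(d) for 3 ‖ d is good
supersingular at 3 with a₃ ∈ {0, ±3} — certified in kernel at the two rung pairs (d = −15).

NUMBERS. Census (pss cell, CENSUS/additive_classes_v2): Gss2 at 3 = 1 060 isogeny classes (r0 705,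
r1 355; r1: 257 with ρ̄₃ onto, 98 not onto, all irreducible); smallest conductor 2205. Local data at
3 for Gss2: e = 2, f₃ = 2, Kodaira I₀*, c₃ ∈ {1, 2, 4}; partner V good supersingular at 3 with
#Ṽ(𝔽₃) ∈ {1, 4, 7}. CST14 Thm 1.5 constants at Σ_D = {3}: factor 2^{−#Σ_D} = 1/2, u_K = 1 for d ≠
−3, −4. Printed ceilings: split-p signed IMC (CastellaWan2022: p ≥ 5 in the ⊇ direction via Wan),
inert p (BBL 2022: p ≥ 5, a_p = 0, definite), ramified p (BKNO 2026: CM only, p ≥ 5). bc5 (trib-w,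
rev 1): rungs `…Theorems.RamifiedHeegnerPairRung.rung_308025h1_1369c1` (p590365) and
`rung_475650cs1_10570k1` (p590699) = X1 ∧ X2 at the certified 3-ramified twist pairs (308025h1,
1369c1, −15) [(r_an W, r_an V) = (0, 1)] and (475650cs1, 10570k1, −15) [(1, 0)], kernel-checked
local data, displayed binders GZK + per-member Kolyvagin Heegner-index certificates at p = 3; N_W ≥
5000 outside the verified-BSD₃ regime (Miller 2011 Thm 7.2: N < 5000); machine T3 clean. Instances,
not the cruxes. Member-cut census (rhp-p1 g2 / rhp-p2 g2, Cremona N < 5·10⁵): r1 355 = 9 intrinsic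
(every member 3 ∣ #Ш_an; 8 on the FW locus, 1 off: 133956n, no multiplicative prime) + 346 with a
3-unit member; Tamagawa profile of r1: 9 classes with 3 ∤ ∏ c_ℓ, 108 with exactly one c_ℓ divisible
by 3, 238 with ≥ 2; r0 705 = 366 intrinsic (273 on the FW locus, 93 off — 77 split-multiplicative
only, 5 with ρ̄₃ unramified at every multiplicative prime, 11 with no multiplicative prime) + 339
with a 3-unit member; U₀ off-print rows: 284 onto-but-Tamagawa + 53 normaliser-image classes. Items
after rev 35 (RANKED CRUXES above): members 26021–26024 with the families of #2/#3, the by-name NUM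
item 32276 (rev 26; crux, cone `grace` since rev 34), support 19921, the asides (since rev 34 incl.
(G3) 27595 r305 and NUM_leaf 32139 r302), closed 25113 · 27202 · 25144 · Assembly 23195 — structure
n 39 = crux 8 · support 11 · aside 19 · assembly 1, counted BY LEDGER KIND (director (592)); 0 items
closed or refuted since rev 16; 1 item added since rev 27 (27595, rev 28); rev 29 = 32276's kind
restored; revs 30–33 (pens g27/g28) text only; rev 34 (pen g28) kinds only (27595 → aside; the
render re-ran the cone pass: 32139 → aside, 32276 grace; commit 26443160db0f); this fold (pen g29)
text only (no statement, kind, glue or import change); registered lines of record partnerdescent v14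
189d0b4b71b1a57e (26022, 11:52:23Z 08-31) and splitkolyvagin0 v27 3e98c0bf76c5e1c7 (26024,
11:54:35Z), FIVE stubs each — INPUTS-1 DELTA-168 (A) 4ec74dcab4a5220b: RHP binder row 4/0/9/0/6/0,
BINDER LEDGER 19a0fd6f1421c087; LEAD FINALs (helpers `--supports 26022`, 0 sorry, count-neutral):
g55 15:32:43Z `blocked-on: 27493` (residue) … g60 01:17:27Z 08-31 · g61 02:26:07Z (8: p801603 …
p802976) · g62 03:52:53Z (p805897 · p806900 · p808779) · g63 05:51:08Z (10: p810424 … p812314; Step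
2 CUT) · g64 08:10:05Z (12: p812855 … p816480) · g65 09:23:43Z (8: p817134 … p817968; (HT) PROVED) ·
g66 10:22:19Z (p819076 · p819594) · g67 11:57:57Z (facts p820894 · p821944, helpers p821231 ·
p822029; v14/v27; `blocked-on: 27493`) · g68–g72 event-less; LEAD SUMMON-ONLY since (828). D-0170(1)
RESIDUAL FLAGS (ledger labels, gen 0, pen g27): 26023 `Gss2LowerAtThreeRankZero` 02:11:37Z and 27201
`Gss2LowerAtThreeRankOneNonTower` 02:11:42Z 2026-08-31; 26024 deliberately NOT flagged (director
(736)); `finish.residual_open` = 2. tribunal_fit (current): witness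
`Summit.BirchSwinnertonDyer.BirchSwinnertonDyer.Theorems.RamifiedHeegnerPairL1Intrinsic.l1_at_133956n1`
(non-degenerate L₁-type instance: (ℤ/3)² ⊆ Ш certified at the intrinsic rank-1 class 133956n,
trib-w; replaced the rev-5 rung), residual [Gss2LowerAtThreeRankZero, LeafRankZeroUpperAtThree,
Gss2LowerAtThreeRankOneNonTower], method_family heegner-kolyvagin. TWIST-UNIT CENSUSES (tribunal-w
g11–g15; `Cruxes/RamifiedPairUpperBound/TU1-CENSUS.md`, `TU0-CENSUS.md` 2bde58e1b204,
`TU0-ADD-CENSUS.md`, `TU-INERT-CENSUS.md`, `TU0-INERT-CENSUS.md` + ADDENDUM-g15,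
`TU-SAVING-CENSUS.md`, `TU0-SAVING-CENSUS.md`; evidence 26022/26024): TU₁ holds per class on 355/355
rank-one Gss2 classes (N < 5·10⁵) — per class an odd Heegner D (all ℓ ∣ N split, 3 ∤ D, |D| ≤ 5879)
with L(E^D,1) ≠ 0 and 3 ∤ #Ш(E^D)_an (101 of 650 computed non-vanishing twists have 3 ∣ #Ш_an — the
per-D failure mode is real; no class lacks a unit twist); kernel instances `u1_at_…` / `bsd3_at_…`
×10 (the 9 Tamagawa-free classes + 205128l2; p633236–p634738); TU₀|3Nn: 53/53 normaliser-image
rank-0 classes have a 3-adic-UNIT Heegner twist of analytic rank one (kernel `u0_at_352800lp1` /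
`bsd3_at_352800lp1`, p641377/p647201); single-ADDITIVE-carrier classes: per-curve KERNEL instances
of U₁ on 10/10 r1 curves and of U₀ on 43/43 r0 classes (p646214/p646215); two-SPLIT-carrier
(pairing-Shimura) rows: unit-twist doors `u1_at_<label>` on ALL 116 typed-reachable rank-one classes
of 129 (p667190, max |D| 1487) and `u0_at_<label>` on 50/51 typed-reachable rank-zero classes of 61
(p670752, p694479/p694562) — 457470bj1 UNREACHED (1156 admissible |D| ≤ 700000 probed; its only
point-bearing twist D = −150143 has X = 36, 3 ∣ #Ш_an; needs 4-descent or a Heegner computation at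
N(Wd) ≥ 2·10¹²); 13 r1 + 10 r0 two-split rows are out of typed reach (an instrument clause, not
data); SAVING rows: `u1s_at_<label>` on 82/82 r1 classes (p689492; ρ̄₃ onto PROVED in kernel by a
Frobenius-order witness) and `u0s_at_<label>` on 30/30 r0 (p694377). Refuter-relevant: X = 9 (3 ∣
#Ш_an(E^D)) does occur (296820ba1 at five D, 341910cd1 at D = −10703) — the failure mode a
twist-unit hypothesis must dodge (TU asks ONE good D per curve); every typed-reachable class but
457470bj1 carries a certified twist-unit KERNEL instance of its U-member. HEEGNER-INDEX CENSUS
(trib-w g16; `Cruxes/RamifiedPairLowerBound/A-INDEX-CENSUS.md` c00df6005811; evidence on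
27200/26021/27201/23191): at the g11 TU₁ unit field of every r1 class the EXACT Heegner multiplier
n₁ (2y_K = n₁g + T) is determined on 355/355 (GZ heights agree), the Gross–Zagier form of BSD₃ over
K (Jetchev 2008 Conj. 1.1) holds 355/355 at the A-field and 898/898 over all (class, D) pairs (161
with 3 ∣ #Ш(E^D)_an, visibility-consistent); M₀ := ord₃ n₁ ∈ {0×1, 1×113, 2×202, 3×37, 4×2} and M₀ =
ord₃∏c(E) EXACTLY on every unit row (Jetchev's Conj. 1.3 shape where his (*) p ∤ N fails) ⇒ the
∃-body of A 27200 with n = 1 is witnessed on 346/355 classes and has NO n = 1 witness at the 9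
intrinsic classes; 3 ∤ n₁ at 475650cs1 only; optimality caveat on 10 classes; no such table in print
(GJPST09 needs p² ∤ N; Jetchev Thm 1.4 needs p ∤ N) — data, not a Lean instance. Rank-zero twin
`A0-INDEX-CENSUS.md` 11b6a635e96f (evidence on 26023/26024/23191): ord₃[E(K):ℤy_K] observed EXACTLY
on 642/705 r0 classes, bookkeeping identity 653/653 pairs, index = Tamagawa 3-part on 319/319 unit
pairs, Ш(E)[3] VISIBLE in the index on 325/325 pairs (322 classes with 9 ∣ #Ш(E)_an) — the data side
of L₀ 26023, nothing booked. SIGMA-TEST v1.4 @d3c484d6e983 (evidence 27493/26022/23192) = CHEAPEST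
FALSIFIER (3): calibration on the whole engine-visible slice of Σ★″ at ℓ₂ = 2, no kill power; the s′
= 2 content layer is invisible to every E[3]-valued instrument (Ē(𝔽₄) = E[3]) — hence the mod-9
protocol (4); L0-SEL3-CENSUS (g18): 366/366 C (2). These are instances of and evidence for the ROADS
— not items, not progress on the leaf. BSD is not proved; all four members are OPEN.

DEFINITION REQUESTS. Cite facts wanted for the LINES (typer tasks; nothing in `closes` blocks on
them): (1) `fact: FriedbergHoffstein1995 Thm B in prescribed-local-class form` (prescribed classes
at v ∈ {3, ∞} ∪ S, root number −1 ⇒ infinitely many simple-zero twists; the tree's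
`…_simpleZero_ramifiedAt_splitAt` covers a multiplicative q only) — PARTLY SUPPLIED by the named
facts `friedbergHoffstein_exists_twist_ne_zero_inertAt_sq_splitTwo` (p768129) /
`…_simpleZero_inertAt_sq_splitTwo` (p773715), the FH supplies of the habitat lines; (2) `fact:
CaiShuTian2014 Thm 1.5 general form` (Σ ⊇ primes v ∣ (N, D)) — the tree's
`ExplicitGrossZagierJointRamification.thm15_ringClassChar_primeConductor_dvd_level` has Σ = {q ‖ N}
only; (3) `fact: Nekovar2007 Thm 3.2 p-exact form` is NOT in print (U₁ line material over the
ramified field; the split-field road does not need it); the character-group facts DICT♭ (p820894) /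
M1 (p821944) LANDED at g67. No new notion is needed: all items are stated over existing
declarations.

Novelty: Searches (2026-08-27): `lit search --hybrid "plus minus Selmer supersingular ramified extension
Coleman maps"` (8 docs; hit paper:arxiv-2608.06879 BKNO 2026 CM ramified); `lit vsearch "signed
Selmer groups … ramified extension … ramification index at most p−1"` (8, textbooks only); `lit
vsearch "anticyclotomic main conjecture … p ramified … supersingular, Heegner points"` (8; Kriz 2021
book p.11/16/34); `lit search --hybrid "cube sum Gross-Zagier 3-part Selmer Heegner"`
(Burungale–Tian 2025 p-converse only); `lit read paper:arxiv-1408.1733` (CST14 Thm 1.5, Special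
cases 1–2, pp. 6–7); `lit read arxiv:2211.03722` pp. 1–3 (BBL: split or inert, p ≥ 5); `lit galaxy
search "plus and the minus Selmer|signed Selmer groups over|supersingular primes in ramified" --star
all` (0/0/0 hits); `lit galaxy search "p ramified in K|ramified in the imaginary quadratic|at
ramified primes" --star all` (panama 10 incl. Kriz AMS-212 = galaxy:panama:391752557002789; pdf 10,
none on BSD; crabby 0); tree: `rg` over Literature/NumberTheory/EllipticCurves
(Kriz2021/AnticyclotomicPAdicLFunction.lean: p ∤ N and Heegner hypothesis only;
ShimuraCurveHeegnerSystemPrimitivesAtThree*: 3 split/inert in K only;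
ExplicitGrossZagierJointRamification: Σ = {q ‖ N}); `ledger negatives --problem BirchSwinnertonDyer`
(1 entry, unrelated); `ledger route ls` (30 BSD routes: none ramifies p in the Heegner field).
Nearest prior art found: arXiv:2608.06879 (Burungale–Kobayashi–Nakamura–Ota 2026: signed
anticyclotomic IMC fo  [refs: 2211.03722, 2608.06879, paper:arxiv-2608.06879, paper:arxiv-1408.1733, arxiv:2211.03722, Kriz2021, CaiShuTian2014, CaiShuTian2017, Kriz2020]

Barriers (technique_class: heegner-kolyvagin, signed-anticyclotomic, ramified-base): - technique_class: heegner-kolyvagin, signed-anticyclotomic, ramified-base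
- Literature.Barriers.BirchSwinnertonDyer.NoAdmissiblePrimesAtThree: conceded for its class and
designed around — no level raising / bipartite Euler system anywhere (3 ∣ ℓ² − 1 kills admissible
primes); C2 uses Kolyvagin primes (Frob conjugate to complex conjugation in K(E[3^n])/ℚ, which
exist), C1 asks for the Heegner-point main conjecture ⊇ by signed Iwasawa theory + reciprocity, not
by level raising. It does not evade the absence of a printed ⊇ engine at p = 3; the bet is that the
ramified-𝔭 local sign decomposition (BKNO 2026 in the CM case) has a crystalline non-CM analogue at
e = 2 = p − 1.
- Literature.Barriers.BirchSwinnertonDyer.HeegnerPointBarrier: outside — r_an(A/K) = 1 by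
construction (r_an(E) + r_an(E^(d)) = 1), the only regime where CM points are non-torsion; nothing
is claimed in rank ≥ 2.
- Literature.Barriers.BirchSwinnertonDyer.CMRankOneAtRamifiedPrime: outside — the leaf is non-CM (¬
W.HasCM is a hypothesis of every item); the CM ramified case is BKNO 2026's theorem, used only as
the transfer sibling.
- Literature.Barriers.BirchSwinnertonDyer.EulerSystemBigImageBarrier: inside for C2 on the 98 r1
Gss2 classes with ρ̄₃ not onto (all irreducible): conceded as C2's why-might-fail; on the 257 onto
classes Gal(K(E[3])/K) ≅ GL₂(𝔽₃) because K ∩ ℚ(E[3]) = ℚ for d ≠ −3.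
- Literature.Barriers.BirchSwinnertonDyer.ReducibleAnticyclotomicAtBadP: outside — every Gss2 class
has ρ̄₃ irreducible (ce

History (route lifecycle, newest last):
- 2026-08-30T06:38:46Z · rev 24: informal re-worded for LeafSigmaStarDivisibilityAtThreeOptimalOffRows (planner-bsd-wall-pss3-g25-0)
- 2026-08-30T15:55:17Z · rev 27: informal re-worded for LeafSigmaStarDivisibilityAtThreeOptimalOffRows (planner-bsd-wall-pss3-g26-0)
- 2026-08-31T02:11:37Z · RESIDUAL declared: Gss2LowerAtThreeRankZero (stmt-BirchSwinnertonDyer-26023) — summit-strength until shown otherwise: D-0170(1) declared residual of RHP (imported rank-ZERO lower bound at the Gss2 leaf; the route's own conjunct is the ran (planner-bsd-wall-pss3-g27-0)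
- 2026-08-31T02:11:42Z · RESIDUAL declared: Gss2LowerAtThreeRankOneNonTower (stmt-BirchSwinnertonDyer-27201) — summit-strength until shown otherwise: D-0170(1) declared residual of RHP (depth-2 remainder of L₁ 26021's split: the 98 `3Nn` rows (ρ̄₃ = C_ns⁺(3)) where the (planner-bsd-wall-pss3-g27-0)
- 2026-08-31T02:45:23Z · rev 30: informal re-worded for LeafSigmaStarDivisibilityAtThreeOptimalOffRows (planner-bsd-wall-pss3-g27-0)
- 2026-08-31T02:45:47Z · rev 31: informal re-worded for PartnerCokernelThreeFree (planner-bsd-wall-pss3-g27-0)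
- 2026-08-31T04:12:45Z · rev 33: informal re-worded for PartnerCokernelThreeFree (planner-bsd-wall-pss3-g28-0)
- 2026-08-31T13:43:26Z · rev 36: informal re-worded for PartnerCokernelThreeFree (planner-bsd-wall-pss3-g29-0)

sub-problem: BirchSwinnertonDyer · status: open · opened planner-bsd-wall-pss3-g9-0 2026-08-27T22:52:42Z · rev 36 · ledger route-BirchSwinnertonDyer-RamifiedHeegnerPair
GENERATED by the gate from the ledger (D-0016/17). Provers cite these decls: `theorem foo : Summit.BirchSwinnertonDyer.BirchSwinnertonDyer.Theses.RamifiedHeegnerPair.<Decl> := …` in Summits/BirchSwinnertonDyer/BirchSwinnertonDyer/Theorems/<Name>.lean.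
-/

namespace Summit.BirchSwinnertonDyer.BirchSwinnertonDyer.Theses.RamifiedHeegnerPair

open scoped BigOperators Topology Manifold Classical MeasureTheory ProbabilityTheory Matrix InnerProductSpace ComplexConjugate ContinuousMap
open Filter Set Function TopologicalSpace MeasureTheory

attribute [summit_statement] _root_.BirchSwinnertonDyer
attribute [summit_statement] _root_.Summit.BirchSwinnertonDyer.WAllExclAddGssAtThree

open Literature

/-- item stmt-BirchSwinnertonDyer-26021 · crux · rank 2 · SPLIT (gen 1) into Gss2LowerPrintedInputsAtThree, Gss2RankOneMcCallumCertificateAtThreeTower, Gss2LowerAtThreeRankOneNonTower + glue Gss2LowerAtThreeRankOneGlue · direct attempts still welcome (low priority) · by planner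
why it might fail: No 3-adic Gross–Zagier / signed anticyclotomic IMC ⊇ is in print or announced at an ADDITIVE 3 over ℚ or at a RAMIFIED supersingular 𝔭 over K (Kobayashi 2013 needs good p; Kriz's 𝓛 is continuous, not Iwasawa; BKNO 2026 is CM, p ≥ 5); class-wide nothing bounds ord₃ #Ш(E) from below.
sources: Kobayashi2013, Kriz2021, arXiv:2608.06879, FouquetWan2021, Kobayashi2003, CastellaWan2022
[crux] DECIDING (L₁; = X1 skeleton v3 stub_gssLowerAtThree_rankOne VERBATIM, rhp-p1 g2
LOWER-HALVES-CORE.md §4 option B): for every non-CM globally minimal E/ℚ additive of class Gss2 at 3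
(e = 2, I₀*, E = V₀ ⊗ χ₋₃ with V₀ good supersingular) with r_an(E) = 1, #Ш(E)_an is a rational q
with ord₃ q ≤ ord₃ #Ш(E) (`Typed.MissingLowerBoundAt E 3`, the IMC-⊇ / Gross–Zagier half of BSD₃(E)
at the rank-one members of the leaf; 355 isogeny classes in the census (N < 5·10⁵): 9 INTRINSIC ones
where every member has #Ш_an = 9 numerically, 346 with a member whose #Ш_an is a 3-unit, where the
half is rationality plus Cassels isogeny transport). The route's LEVER lives here as its LINE: over
the 3-RAMIFIED Heegner field K = ℚ(√d), v₃(d) = 1, E/K is GOOD supersingular at 𝔭 and the old pair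
statement X1 (item 23191, now aside) is L₀ ∧ L₁ modulo {GZK, twist supply, BSD₃ of the good partner}
(p606339 `gssLowerAtThree_of_ramifiedPairLowerBound` /
`ramifiedPairLowerBound_of_gssLowerHalves_of_items`), so every Heegner-point-main-conjecture ⊇ /
signed anticyclotomic IMC ⊇ over the ramified K, or an exact 3-indivisibility of the CM-point index,
proves L₁; per class, a 3-descent exhibiting (ℤ/3)² ⊆ Ш(E) mak -/
@[route_item "route-BirchSwinnertonDyer-RamifiedHeegnerPair", crux]
def Gss2LowerAtThreeRankOne : Prop :=
  ∀ (W : WeierstrassCurve ℚ) [W.IsElliptic] [W.IsGloballyMinimal], ¬ W.HasCM → Literature.NumberTheory.EllipticCurves.Rank1Residual.Addv W 3 → Summit.BirchSwinnertonDyer.Rank1Residual.Additive.SubGss W 3 → W.analyticRank = 1 → Literature.NumberTheory.EllipticCurves.Rank1Residual.Typed.MissingLowerBoundAt W 3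

-- parent: Gss2LowerAtThreeRankOne · child (gen 1)
/--     item stmt-BirchSwinnertonDyer-27200 · crux · rank 202 · open
    parent: Gss2LowerAtThreeRankOne · by planner
    why it might fail: Heegner-point 3-indivisibility within the BSD budget (T1⁻) is proved only at good ordinary p ≥ 5 (W. Zhang 2014 / BCGS, via BD level raising); at 3 there are no admissible primes (NoAdmissiblePrimesAtThree) and 346/355 r1 Gss2 classes have 3 ∣ some c_ℓ, so the depth budget is tight.
    sources: WZhang2014, BurungaleEtAl2026, McCallumLMS1991, Jetchev2008, JetchevLauterStein2009, GrossLMS1991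
[crux; = the LOAD-BEARING stub `stub_existsMcCallumCertificate_towerRows` of the registered line
kolyvagin_split v3 (102a5bdc6a638030, rhp-p1 g4) VERBATIM in fully-qualified spelling; promoted on
the L₁ lead's `promote-stub` (rhp-p1 g3 08:06:58Z; W-81′ children follow the line of record)] For
every globally minimal E/ℚ additive of class Gss2 at 3 (E = V₀ ⊗ χ₋₃, Kodaira I₀*, supersingular)
with r_an(E) = 1 and ρ_{E,3^n} onto for all n: SOME level N = N_E, SOME imaginary quadratic K′ with
the Heegner hypothesis and L(E^{d_K′},1) ≠ 0, SOME datum (Dt, H, ι) with its Heegner point P ∈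
E(K′), SOME globally minimal model Wd of the twist, SOME depth M with 2M ≤ ord₃∏c(E) + ord₃∏c(Wd) +
2·ord₃ c(Dt), and SOME McCallum certificate `X11b.Three.Koly.CertificateAt Dt H.β ι 3 M` (a derived
Heegner point P_n, n ∈ S_r(M+1), NOT 3^{M+1}-divisible in E(K′[n]) — M_∞ ≤ M). = the indivisibility
half T1⁻ of the refined Kolyvagin conjecture at an ADDITIVE 3 in print's own currency;
BSD-consistent (BSD₃(E) ∧ BSD₃(E^d) predict 2M_∞ = the budget at a Manin-exact reading), LOSS-FREE,
certifiable pair by pair (JLS 2009 instrument). With PUB it gives L₁ on the tower rows (p618012 §12;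
composition p619522 §16). -/
@[route_item "route-BirchSwinnertonDyer-RamifiedHeegnerPair", crux]
def Gss2RankOneMcCallumCertificateAtThreeTower : Prop :=
  ∀ (W : WeierstrassCurve ℚ) [W.IsElliptic] [W.IsGloballyMinimal], Literature.NumberTheory.EllipticCurves.Rank1Residual.Addv W 3 → Summit.BirchSwinnertonDyer.Rank1Residual.Additive.SubGss W 3 → W.analyticRank = 1 → (∀ n : ℕ, W.HasSurjectiveModNGaloisRep (3 ^ n : ℕ)) → ∃ (N : ℕ) (_ : NeZero N) (K : Type) (_ : Field K) (_ : NumberField K) (Dt : Literature.NumberTheory.EllipticCurves.ModularForms.ModularParametrizationData W N) (H : Literature.NumberTheory.EllipticCurves.HeegnerDatum N (NumberField.discr K)) (ι : K →+* ℂ) (P : (W.baseChange K).toAffine.Point) (Wd : WeierstrassCurve ℚ) (_ : Wd.IsElliptic) (_ : Wd.IsGloballyMinimal) (Cd : WeierstrassCurve.VariableChange ℚ) (M : ℕ), W.conductorNorm ℤ = N ∧ Literature.NumberTheory.EllipticCurves.IsImaginaryQuadratic K ∧ Literature.NumberTheory.EllipticCurves.SatisfiesHeegnerHypothesis N K ∧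 (W.quadraticTwist (NumberField.discr K : ℚ)).entireLFunction 1 ≠ 0 ∧ WeierstrassCurve.Affine.Point.map ι.toRatAlgHom P = Literature.NumberTheory.EllipticCurves.ModularForms.heegnerPointComplex Dt H ∧ Cd • W.quadraticTwist (NumberField.discr K : ℚ) = Wd ∧ (2 * M : ℤ) ≤ padicValNat 3 W.tamagawaProduct + padicValNat 3 Wd.tamagawaProduct + 2 * padicValRat 3 (Dt.c : ℚ) ∧ Summit.BirchSwinnertonDyer.Rank1Residual.X11b.Three.Koly.CertificateAt Dt H.β ι 3 M

-- parent: Gss2LowerAtThreeRankOne · child (gen 1)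
/--     item stmt-BirchSwinnertonDyer-27201 · crux · RESIDUAL (gen 0; summit-strength until shown otherwise, D-0170) · rank 203 · open
    parent: Gss2LowerAtThreeRankOne · by planner
    why it might fail: On the 98 `3Nn` rows (ρ̄₃ = C_ns⁺(3)) Heegner methods control only the PAIR ord₃#Ш(E)+ord₃#Ш(E^d) (structure theorem under irreducibility: Cha 2005 Rmk 25, MN19 §0.11); separating the members needs a ℚ-method for one half at a non-big-image curve — exactly where Kato (12.5.2) fails.
    sources: Cha2005, MatarNekovar2019, McCallumLMS1991, Kolyvagin1990, Kato2004, JetchevLauterStein2009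
[crux, DECLARED RESIDUAL (tribunal_fit.residual) — the residual OF RECORD on the `3Nn` rows; KERNEL
REDUCTION on file (rhp-p1 g5, 2026-08-28, NOT booked as route structure): NT ⟸ PUB 27199 ∧ STRUCT ∧
A₃ₙₙ ∧ U₀ 26024 — theorem
`…Theorems.RamifiedPairLowerBound.gss2LowerAtThreeRankOneNonTower_of_structIrr_of_certificates3Nn_of_leafRankZeroUpper`
(p625317; road p624620 §8), where STRUCT = the tree's named PRINT fact
`Literature.NumberTheory.EllipticCurves.MatarNekovar2019.thm07_pow_dvd_card_sha_primary_of_certificate_of_irreducible`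
(Kolyvagin's structure theorem under IRREDUCIBILITY: Cha 2005 Thm 21/Rmk 25, Matar–Nekovář 2019 Thm
0.7/§0.11; referee flags MN19-0.11-structure-composite / Kolyvagin1991-ThmCD-primary-unread travel
with it) and A₃ₙₙ = `stub_existsMcCallumCertificate_nonsplitRows` of the registered skeleton
kolyvagin_split v4 (cecbb8355708e296, on 26021): for every non-CM Gss2 r1 curve with ρ̄₃ NOT onto,
SOME odd-discriminant split Heegner frame with a McCallum certificate of adjusted BSD depth (A
27200's currency and instrument; per-pair certifiable, JLS 2009) — helpers instantiating it row by
row are welcome as `--supports stmt-BirchSwinnertonDyer-27201`. TEXT (unchanged -/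
@[route_item "route-BirchSwinnertonDyer-RamifiedHeegnerPair"]
def Gss2LowerAtThreeRankOneNonTower : Prop :=
  ∀ (W : WeierstrassCurve ℚ) [W.IsElliptic] [W.IsGloballyMinimal], ¬ W.HasCM → Literature.NumberTheory.EllipticCurves.Rank1Residual.Addv W 3 → Summit.BirchSwinnertonDyer.Rank1Residual.Additive.SubGss W 3 → W.analyticRank = 1 → ¬ (∀ n : ℕ, W.HasSurjectiveModNGaloisRep (3 ^ n : ℕ)) → Literature.NumberTheory.EllipticCurves.Rank1Residual.Typed.MissingLowerBoundAt W 3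

-- parent: Gss2LowerAtThreeRankOne · child (gen 1)
/--     item stmt-BirchSwinnertonDyer-27199 · support · rank 201 · open
    parent: Gss2LowerAtThreeRankOne · by planner
    sources: GrossZagier1986, Kolyvagin1990, McCallumLMS1991, Kato2004Asterisque
[support, PUB — print inputs, permanently open like PublishedInputsGZK; = registered skeleton v3
(102a5bdc6a638030) `Sig.stub_pub` UNFOLDED: the body of item 20137
`AdditiveKolyvaginRoad.PublishedInputsAdditiveKoly` (ten named published facts: Gross–Zagier
I.(6.3), Kolyvagin, Kolyvagin's Ш-index bound, GZK, modularity as analytic continuation, newforms,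
Hoffstein–Luo, Shimura reciprocity at conductor 1, McCallum 1991 Cor. 5.6, Darmon 2004 Thm. 3.6) ∧
Kato 2004 Thm. 14.5(3)+Prop. 14.16(2) Tamagawa-exact at an additive potentially good prime —
definitionally equal to `Sig.stub_pub` (Iff.rfl, pen scratch), spelled without importing another
route's Theses file] Never counted as progress. -/
@[route_item "route-BirchSwinnertonDyer-RamifiedHeegnerPair", crux]
def Gss2LowerPrintedInputsAtThree : Prop :=
  ((∀ (N : ℕ) [NeZero N] (W : WeierstrassCurve ℚ) (K : Type) [Field K] [NumberField K], Literature.NumberTheory.EllipticCurves.gross_zagier N W K) ∧ (∀ (N : ℕ) [NeZero N] (W : WeierstrassCurve ℚ) (K : Type) [Field K] [NumberField K], Literature.NumberTheory.EllipticCurves.kolyvagin N W K) ∧ (∀ (N : ℕ) [NeZero N] (W : WeierstrassCurve ℚ) (K : Type) [Field K] [NumberField K], Literature.NumberTheory.EllipticCurves.Kolyvagin1990_padicValNat_card_sha_le N W K) ∧ Literature.NumberTheory.EllipticCurves.rank_eq_analyticRank_of_analyticRank_le_one ∧ WeierstrassCurve.hasEntireLFunction_rat ∧ Literature.NumberTheory.EllipticCurves.ModularForms.exists_isNewformOf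 ∧ Literature.NumberTheory.EllipticCurves.HoffsteinLuo1997_exists_twist_L_one_ne_zero ∧ (∀ (N : ℕ) [NeZero N] (W : WeierstrassCurve ℚ) (K : Type) [Field K] [NumberField K], Literature.NumberTheory.EllipticCurves.heegnerPointOfConductor_one_galoisConj N W K) ∧ Literature.NumberTheory.EllipticCurves.McCallum1991_pow_dvd_card_sha_primary_of_certificate ∧ (∀ (N : ℕ) [NeZero N] (W : WeierstrassCurve ℚ) (K : Type) [Field K] [NumberField K], Literature.NumberTheory.EllipticCurves.phi_heegnerTau_mem_range_map_singularModuliField N W K)) ∧ Literature.NumberTheory.EllipticCurves.Kato2004.rankZero_padicValNat_sha_add_padicValNat_tamagawa_le_of_additive_potGood_of_imageContainsSL2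

-- parent: Gss2LowerAtThreeRankOne · glue (gen 1)
/--     item stmt-BirchSwinnertonDyer-27202 · support · rank 204 · closed · proved by Summit.BirchSwinnertonDyer.BirchSwinnertonDyer.Theorems.gss2LowerAtThreeRankOneGlue_proof (prover)
    parent: Gss2LowerAtThreeRankOne · GLUE: children ⟹ parent · by planner
PUB → A → NT → L₁; TURNKEY closer one-liner = fun hP hA hN =>
RamifiedPairLowerBound.gss2LowerAtThreeRankOne_of_exists_mccallumCertificate_of_nonTower hP.1 hP.2
hA hN (p619522 §16; closability also kernel-checked via p618012 §12 in the pen scratch) -/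
@[route_item "route-BirchSwinnertonDyer-RamifiedHeegnerPair"]
def Gss2LowerAtThreeRankOneGlue : Prop :=
  Gss2LowerPrintedInputsAtThree → Gss2RankOneMcCallumCertificateAtThreeTower → Gss2LowerAtThreeRankOneNonTower → Gss2LowerAtThreeRankOne

-- `Gss2LowerAtThreeRankOneGlue` holds: proved by `Summit.BirchSwinnertonDyer.BirchSwinnertonDyer.Theorems.gss2LowerAtThreeRankOneGlue_proof` (its module imports this route file, so no `_holds` link can be stated here).

/-- item stmt-BirchSwinnertonDyer-26022 · crux · rank 3 · SPLIT (gen 1) into LeafRankOnePrintedInputsAtThree, JetchevDivisibilityReadingS2, LeafSigmaStarDivisibilityAtThreeOptimalOffRows + glue LeafRankOneUpperAtThreeGlue · direct attempts still welcome (low priority) · by planner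
why it might fail: Kolyvagin's bound at 3 is Tamagawa-exact only through 2·ord₃ ∏ c_ℓ(E): on 346 of the 355 rank-1 Gss2 classes some c_ℓ is divisible by 3 and the needed global divisibility of derived Heegner classes at an ADDITIVE 3 (Jetchev 2008 Σ-form) is unproved.
sources: Jetchev2008, Kolyvagin1990, MatarNekovar2019, McCallumLMS1991, GrossZagier1986, CaiShuTian2014
[crux] (U₁; = X2 skeleton v4 stub_leafRankOneUpper VERBATIM, rhp-p2 g2 RESTATE DATUM v2): same
hypotheses, r_an(E) = 1, conclusion ord₃ #Ш(E) ≤ ord₃ q (`Typed.MissingUpperBoundAt E 3`, the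
Euler-system half). The old pair statement X2 (item 23192, now aside) is the SUM of the members'
halves over ℚ (X2-ENGINE-AUDIT.md: X2 ⟺ ∀ pairs JointUpperBoundAt, Iff.rfl; p607424
`ramifiedPairUpperBound_of_leafUpper_of_residual`); for the upper half Kolyvagin needs no clause at
p, so a SPLIT Heegner field K′ gives the index bound with typed objects: row by row = the
split-field Kolyvagin socket `IndexUpperBoundLeAt E 3 K′ P (v₃ c)` + the rank-0 Gss2 twist's LOWER
half (p606327 §2); PRINT on the 9 Tamagawa-free r1 classes (McCallum 1991 §1 / MN19 Thm 0.7, ρ̄₃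
irreducible automatic on Gss2), the research input on the other 346/355 classes (108 with one
Tamagawa-3 prime, 238 with ≥ 2) is Tamagawa-exact global divisibility of derived Heegner classes at
an additive 3 (Jetchev's Σ-form, `AdditiveThree.RKC3Divisibility`-shape; tower form p607034,
irreducible form p607279). [deps: PublishedInputGZK] [difficulty: XL] -/
@[route_item "route-BirchSwinnertonDyer-RamifiedHeegnerPair", crux]
def LeafRankOneUpperAtThree : Prop :=
  ∀ (W : WeierstrassCurve ℚ) [W.IsElliptic] [W.IsGloballyMinimal], ¬ W.HasCM → Literature.NumberTheory.EllipticCurves.Rank1Residual.Addv W 3 → Summit.BirchSwinnertonDyer.Rank1Residual.Additive.SubGss W 3 → W.analyticRank = 1 → Literature.NumberTheory.EllipticCurves.Rank1Residual.Typed.MissingUpperBoundAt W 3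

-- parent: LeafRankOneUpperAtThree · child (gen 1)
/--     item stmt-BirchSwinnertonDyer-27493 · crux · rank 303 · open
    parent: LeafRankOneUpperAtThree · by planner
    why it might fail: Σ-form = W. Zhang's refined Kolyvagin conjecture, proved only for p > 3 good ordinary (BCGS arXiv:2312.09301 Thm 2, via acIMC); at ADDITIVE 3 acIMC is absent, Jetchev Thm 1.4 pays one multiplicative carrier, his method caps at max_ℓ ord₃c_ℓ; n = 1 = 3-integrality of #Ш_an(E/K) on 247 r1 + 146 r0.
    sources: Jetchev2008, JetchevLauterStein2009, MatarNekovar2019, GrossZagier1986, arXiv:2312.09301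
[crux, RESEARCH RESIDUE OF THE U-SIDE, LOAD-BEARING, ORIENTATION-FREE (Σ★″) — TEXT = hypothesis
`hStar` of p622097: for a non-CM LEAF curve W (additive Gss2 at 3), N = N_W, a LATTICE-OPTIMAL
parametrisation datum Dt (Λ_E = c·Λ_f), OFF the mono-multiplicative-carrier rows, K imaginary
quadratic with odd d_K, Heegner for N, P the Heegner point, non-torsion: every derived Heegner point
P_n (n squarefree, Kolyvagin primes of index ≥ s′) is 3^{s′}-divisible in E(K[n]) (`Koly.PDiv`) for
all s′ ≤ B := ord₃ ∏c_ℓ + v₃(c). NO r_an / twisted-L binder, NO Manin clause. Σ★″ ⟺ Σ″ ∧ Σ₀″ mod GZ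
(p622097); no surplus over BSD₃ on the leaf (p626741: Σ★″ ⟺ U₁ ∧ U₀ mod {PUB⁺, S2, L₁, L₀, MN
§0.11}). DISPROOF OF RECORD (cdisprove, `Cruxes/<Decl>/Disproof.lean` @cdff72e561df, no kill): §2
the budget clause s′ ≤ B is LOAD-BEARING (`Negative/BudgetLoadBearing` p766049: no y_K is infinitely
3-divisible); §3 McCallum 5.1 threshold — at n = 1, PDiv ⟺ s′ ≤ ord₃[E(K):ℤP]
(`Negative/IndexThreshold` p768463, irreducible-row forms `…Sharp` p768620), so «budget+1» is FALSE
at n = 1 modulo the per-row index hypothesis ord₃[E(K):ℤP] ≤ B (§3b: ⇐ BSD₃(E) ∧ BSD₃(E^{d_K}) ∧ 3 ∤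
#Ш(E/K)); §3c ROW-WISE SHARPNESS mod BSD₃- -/
@[route_item "route-BirchSwinnertonDyer-RamifiedHeegnerPair", crux]
def LeafSigmaStarDivisibilityAtThreeOptimalOffRows : Prop :=
  ∀ (W : WeierstrassCurve ℚ) [W.IsElliptic] [W.IsGloballyMinimal] (N : ℕ) [NeZero N] (K : Type) [Field K] [NumberField K] (Dt : Literature.NumberTheory.EllipticCurves.ModularForms.ModularParametrizationData W N) (H : Literature.NumberTheory.EllipticCurves.HeegnerDatum N (NumberField.discr K)) (ι : K →+* ℂ) (P : (W.baseChange K).toAffine.Point), ¬ W.HasCM → Literature.NumberTheory.EllipticCurves.Rank1Residual.Addv W 3 → Summit.BirchSwinnertonDyer.Rank1Residual.Additive.SubGss W 3 → W.conductorNorm ℤ = N → (∀ z ∈ Dt.L.lattice, ∃ w ∈ Literature.NumberTheory.EllipticCurves.ModularForms.periodLattice Dt.f, z = Dt.c * w) → ¬ ((∃ (q : ℕ) (_ : Fact q.Prime), q ∣ N ∧ ¬ q ^ 2 ∣ N ∧ padicValNat 3 W.tamagawaProduct ≤ padicValNat 3 ((W.baseChange ℚ_[q]).localTamagawaNumber ℤ_[q]))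 ∧ (∀ (q' : ℕ) [Fact q'.Prime], q' ∣ N → 3 ∣ (W.baseChange ℚ_[q']).localTamagawaNumber ℤ_[q'] → ¬ q' ^ 2 ∣ N)) → Literature.NumberTheory.EllipticCurves.IsImaginaryQuadratic K → Literature.NumberTheory.EllipticCurves.SatisfiesHeegnerHypothesis N K → (WeierstrassCurve.Affine.Point.map ι.toRatAlgHom) P = Literature.NumberTheory.EllipticCurves.ModularForms.heegnerPointComplex Dt H → ¬ IsOfFinAddOrder P → Odd (NumberField.discr K) → ∀ (s' : ℕ), s' ≤ padicValNat 3 W.tamagawaProduct + padicValNat 3 Dt.c.natAbs → ∀ (n : ℕ) (d : Literature.NumberTheory.EllipticCurves.KolyvaginHeegnerData Dt H.β ι n), Squarefree n → (∀ ℓ ∈ n.primeFactors, Literature.NumberTheory.EllipticCurves.Zhang2014.IsKolyvaginPrime N W K 3 ℓ ∧ s' ≤ Literature.NumberTheory.EllipticCurves.Zhang2014.kolyvaginIndex W 3 ℓ) → Summit.BirchSwinnertonDyer.Rank1Residual.X11b.Three.Koly.PDiv d 3 s'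

-- parent: LeafRankOneUpperAtThree · child (gen 1)
/--     item stmt-BirchSwinnertonDyer-27491 · support · rank 301 · open
    parent: LeafRankOneUpperAtThree · by planner
    sources: GrossZagier1986, Kolyvagin1990, McCallumLMS1991, MatarNekovar2019, FriedbergHoffstein1995, Cassels1965ArithmeticVIII
[support, PUB⁺ — PRINT inputs, permanently open like PublishedInputGZK / the L₁ PUB child 27199; =
registered skeleton splitkolyvagin v5 (sha16 5a63be1c29acb0db, lead rhp-p2 g6)
`stub_publishedInputsU1Manin` VERBATIM (token-identical): Gross–Zagier I.6.3 ∀ · Kolyvagin 1990 Thm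
A ∀ · GZK over ℚ · entire L · Gross–Zagier I.(7.3) · Matar–Nekovář 2019 Thm 0.7 · modularity
(newform of E) · Friedberg–Hoffstein 1995 Thm B · existence of a parametrisation datum · Cassels
isogeny invariance of the BSD quotient · Mazur 1978 Cor 4.1 · Abbes–Ullmo 1996 Thm A · Česnavičius
2018 Thm 1.2 — all NAMED FACTS of the tree; the closed ones are item-stated BY NAME as asides of
this route (rev 10). Never counted as progress.] -/
@[route_item "route-BirchSwinnertonDyer-RamifiedHeegnerPair", crux]
def LeafRankOnePrintedInputsAtThree : Prop :=
  (∀ (N : ℕ) [NeZero N] (W : WeierstrassCurve ℚ) (K : Type) [Field K] [NumberField K], Literature.NumberTheory.EllipticCurves.gross_zagier N W K) ∧ (∀ (N : ℕ) [NeZero N] (W : WeierstrassCurve ℚ) (K : Type) [Field K] [NumberField K], Literature.NumberTheory.EllipticCurves.kolyvagin N W K) ∧ Literature.NumberTheory.EllipticCurves.rank_eq_analyticRank_of_analyticRank_le_one ∧ WeierstrassCurve.hasEntireLFunction_rat ∧ Literature.NumberTheory.EllipticCurves.GrossZagier1986_thm_I_7_3 ∧ Literature.NumberTheory.EllipticCurves.MatarNekovar2019.thm07_padicValNat_card_sha_primary_add_le_of_globalDivisibility_of_irreducible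 ∧ Literature.NumberTheory.EllipticCurves.ModularForms.exists_isNewformOf ∧ Literature.NumberTheory.EllipticCurves.friedbergHoffstein_exists_heegnerField_splitDivisors_twist_ne_zero ∧ Literature.NumberTheory.EllipticCurves.ModularForms.nonempty_modularParametrizationData ∧ WeierstrassCurve.bsdRHS_eq_of_isIsogenous ∧ Literature.NumberTheory.EllipticCurves.ModularForms.mazur_not_dvd_maninConstant_of_odd ∧ Literature.NumberTheory.EllipticCurves.ModularForms.abbesUllmo_not_dvd_maninConstant_of_not_dvd_level ∧ Literature.NumberTheory.EllipticCurves.ModularForms.cesnavicius_not_two_dvd_maninConstant_of_two_dvd_level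

-- parent: LeafRankOneUpperAtThree · child (gen 1)
/--     item stmt-BirchSwinnertonDyer-27492 · aside · rank 302 · open
    parent: LeafRankOneUpperAtThree · by planner
    why it might fail: Jetchev 2008 Thm 1.4 is printed for p ∤ N·D_K with Gal(ℚ(E[p])/ℚ) ≅ GL₂; here p² ∣ N (additive, pot. good) and only E[p] irreducible (MN19 Thm 0.7): the local condition at p and the Čebotarev/pairing step of §§4–6 must be re-read off print; no statement in print covers p ∣ N.
    sources: Jetchev2008, MatarNekovar2019, GrossLMS1991, McCallumLMS1991
[crux, READING-GRADE, shared VERBATIM with cell bsd-potss's skeleton node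
`Sig.S2DivisibilityIrredAddv` (crux 20165 family;
Cruxes/JetchevIrreducibleReadingByName/Lines/birth.lean) and = registered stub
`stub_jetchevDivisibilityReadingS2` of splitkolyvagin v5 (26022) AND splitkolyvagin0 v4 (26024): the
DIVISIBILITY READING of Jetchev 2008 Thm 1.4 at ONE multiplicative Tamagawa carrier q ≠ p — for E/ℚ
non-CM globally minimal, K imaginary quadratic with d_K ∉ {−3,−4} and Heegner for N_E, p odd
ADDITIVE potentially good (`Addv`, 0 ≤ v_p j), E[p] irreducible, p ∤ c_p, every Tamagawa-p carrier
multiplicative, the basic Heegner point non-torsion, q ∥ N_E, s ≤ ord_p c_q: every derived Heegner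
point P_n (n squarefree, Kolyvagin primes of index ≥ s) is p^s-divisible in E(K[n]). No
analytic-rank binder, so ONE reading serves U₁ and U₀; pays the 99 mono-carrier r1 (and 190 r0) Gss2
classes. In potss's kernel S2 ⟸ stub_prop52IrredP ∧ stub_coreVertexExistenceIrredP ∧ print (bridge
…ReadingDivisibilityCoreVertexBridgePrimed).] -/
@[route_item "route-BirchSwinnertonDyer-RamifiedHeegnerPair", crux]
def JetchevDivisibilityReadingS2 : Prop :=
  ∀ (W : WeierstrassCurve ℚ) [W.IsElliptic] [W.IsGloballyMinimal] [NeZero (W.conductorNorm ℤ)], ¬ W.HasCM → ∀ (K : Type) [Field K] [NumberField K], Literature.NumberTheory.EllipticCurves.IsImaginaryQuadratic K → NumberField.discr K ≠ -3 → NumberField.discr K ≠ -4 → Literature.NumberTheory.EllipticCurves.SatisfiesHeegnerHypothesis (W.conductorNorm ℤ) K → ∀ (p : ℕ) [Fact p.Prime], p ≠ 2 → Literature.NumberTheory.EllipticCurves.Rank1Residual.Addv W p → 0 ≤ padicValRat p W.j → W.HasIrreducibleModPGaloisRep p → ¬ p ∣ (W.baseChange ℚ_[p]).localTamagawaNumber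 ℤ_[p] → (∀ (q' : ℕ) [Fact q'.Prime], q' ∣ W.conductorNorm ℤ → p ∣ (W.baseChange ℚ_[q']).localTamagawaNumber ℤ_[q'] → ¬ q' ^ 2 ∣ W.conductorNorm ℤ) → ∀ (Dt : Literature.NumberTheory.EllipticCurves.ModularForms.ModularParametrizationData W (W.conductorNorm ℤ)) (β : ℤ) (ι : K →+* ℂ) (d₁ : Literature.NumberTheory.EllipticCurves.KolyvaginHeegnerData Dt β ι 1), ¬ IsOfFinAddOrder d₁.derivedPoint → ∀ (q : ℕ) [Fact q.Prime], q ∣ W.conductorNorm ℤ → ¬ q ^ 2 ∣ W.conductorNorm ℤ → q ≠ p → ∀ (s : ℕ), s ≤ padicValNat p ((W.baseChange ℚ_[q]).localTamagawaNumber ℤ_[q]) → ∀ (n : ℕ) (d : Literature.NumberTheory.EllipticCurves.KolyvaginHeegnerData Dt β ι n), Squarefree n → (∀ ℓ ∈ n.primeFactors, Literature.NumberTheory.EllipticCurves.Zhang2014.IsKolyvaginPrime (W.conductorNorm ℤ) W K p ℓ ∧ s ≤ Literature.NumberTheory.EllipticCurves.Zhang2014.kolyvaginIndex W p ℓ) →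 ∃ Q : (W.baseChange (Literature.NumberTheory.EllipticCurves.ringClassField K ι n)).toAffine.Point, ((p ^ s : ℕ) : ℤ) • Q = d.derivedPoint

-- parent: LeafRankOneUpperAtThree · glue (gen 1)
/--     item stmt-BirchSwinnertonDyer-27494 · support · rank 304 · open
    parent: LeafRankOneUpperAtThree · GLUE: children ⟹ parent · by planner
glue G₁ := LeafRankOnePrintedInputsAtThree → JetchevDivisibilityReadingS2 →
LeafSigmaStarDivisibilityAtThreeOptimalOffRows → LeafRankOneUpperAtThree. HONESTLY L₀-CONDITIONAL
(L₀ = Gss2LowerAtThreeRankZero 26023 is a binder of closes; a by-name L₀ child would be a forward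
reference in the rendered file): closer (farm rc 0, pss3 g19 rhp/usplit/scratch-v5-closer.lean; to
be landed --supports this item by the U-lead rhp-p2): theorem
leafRankOneUpperAtThreeGlue_of_lowerRankZero : Gss2LowerAtThreeRankZero →
LeafRankOneUpperAtThreeGlue := fun hL0 hP hS hSig =>
Summit.BirchSwinnertonDyer.BirchSwinnertonDyer.Theorems.RamifiedPairUpperBound.leafRankOneUpperAtThree_of_pubManin_of_divisibilityReading_of_sigmaOptOffRows_of_lowerRankZero
hP hS
(Summit.BirchSwinnertonDyer.BirchSwinnertonDyer.Theorems.RamifiedPairUpperBound.sigmaOptOffRows_of_sigmaStarOptOffRows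
hSig) hL0 (p622097 + …LeafRankOneUpperAtThreeOptimalMember). Children = registered skeleton
splitkolyvagin v5 (sha16 5a63be1c29acb0db) stubs VERBATIM. -/
@[route_item "route-BirchSwinnertonDyer-RamifiedHeegnerPair"]
def LeafRankOneUpperAtThreeGlue : Prop :=
  LeafRankOnePrintedInputsAtThree → JetchevDivisibilityReadingS2 → LeafSigmaStarDivisibilityAtThreeOptimalOffRows → LeafRankOneUpperAtThree

/-- item stmt-BirchSwinnertonDyer-26023 · crux · RESIDUAL (gen 0; summit-strength until shown otherwise, D-0170) · rank 4 · open · by planner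
why it might fail: Kato's divisibility at an additive 3 (Astérisque 295 Thm 12.10/17.4) is an inclusion after ⊗ℚ_p or up to the image index; an index-exact ⊇ at p = 3 additive potentially supersingular is in print for no class (Fouquet–Wan is announced, PRE on the FW locus only).
sources: Kato2004Asterisque, FouquetWan2021, Fouquet2025EquivariantTNC, SkinnerUrban2014
[crux] (L₀; = X1 skeleton v3 stub_gssLowerAtThree_rankZero VERBATIM) RESIDUAL-TYPE conjunct
(declared in tribunal_fit.residual; no RHP lineage attacks it — it is the rank-0 Gss2 lower half
shared BY SHAPE with the K8/K9/QBSC KMC₃ programme): for every non-CM globally minimal E/ℚ of class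
Gss2 at 3 with r_an(E) = 0, #Ш(E)_an is a rational q with ord₃ q ≤ ord₃ #Ш(E). Roads: Kato 2004 Thm
12.10/17.4-type divisibility at an additive potentially good 3 made index-exact (PRE) on the
Fouquet–Wan locus (rhp-p1 g2 census of the 705 r0 Gss2 classes: 366 intrinsic (every member 3 ∣
#Ш_an), of which 273 lie on the FW locus (PRE-reducible by the FW claim + the cell's KMC descent)
and 93 off it with nothing announced; the 339 non-intrinsic classes have a 3-unit member
(rationality + Cassels transport) — still one ∀-statement). Inside the old cone this was the
W-rank-0 orientation of X1 (pairs (E, V) with r_an(V) = 1). [deps: PublishedInputGZK] [difficulty: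
open-problem] -/
@[route_item "route-BirchSwinnertonDyer-RamifiedHeegnerPair", crux (bottleneck := idea) (source := "ledger wanted_by.residual on stmt-BirchSwinnertonDyer-26023, 2026-09-01")]
def Gss2LowerAtThreeRankZero : Prop :=
  ∀ (W : WeierstrassCurve ℚ) [W.IsElliptic] [W.IsGloballyMinimal], ¬ W.HasCM → Literature.NumberTheory.EllipticCurves.Rank1Residual.Addv W 3 → Summit.BirchSwinnertonDyer.Rank1Residual.Additive.SubGss W 3 → W.analyticRank = 0 → Literature.NumberTheory.EllipticCurves.Rank1Residual.Typed.MissingLowerBoundAt W 3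

/-- item stmt-BirchSwinnertonDyer-26024 · crux · rank 5 · open · by planner
why it might fail: Kato 2004 Thm 17.4 at an additive 3 bounds #Sel only up to the Tamagawa/torsion index and needs the 3-adic tower image large: off the Kato-sharp rows (284 onto-Tamagawa + 53 normaliser classes of 705) no upper bound at 3 is in print.
sources: Kato2004Asterisque, MatarNekovar2019, Miller2011LMS, SkinnerUrban2014
[crux] (U₀; = X2 skeleton v4 stub_leafRankZeroUpper VERBATIM) RESIDUAL-TYPE conjunct (declared in
tribunal_fit.residual; no RHP lineage attacks it): for every non-CM globally minimal E/ℚ of class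
Gss2 at 3 with r_an(E) = 0, ord₃ #Ш(E) ≤ ord₃ q (`Typed.MissingUpperBoundAt E 3`). PRINT on the
Kato-sharp rows (3-adic tower image onto ∧ 3 ∤ ∏ c_ℓ ∧ 3 ∤ c_D:
`leafRankZeroUpper_three_of_kato_on_sharp_rows`, p606731,
Theorems/RamifiedHeegnerPairRamifiedPairUpperBoundMembersOnRows.lean); open off rows (rhp-p2 g2
census: 284 onto-but-Tamagawa classes + 53 normaliser-image classes of the 705 r0 Gss2 classes).
Inside the old cone this was the W-rank-0 orientation of X2. [deps: PublishedInputGZK] [difficulty: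
L] -/
@[route_item "route-BirchSwinnertonDyer-RamifiedHeegnerPair", crux]
def LeafRankZeroUpperAtThree : Prop :=
  ∀ (W : WeierstrassCurve ℚ) [W.IsElliptic] [W.IsGloballyMinimal], ¬ W.HasCM → Literature.NumberTheory.EllipticCurves.Rank1Residual.Addv W 3 → Summit.BirchSwinnertonDyer.Rank1Residual.Additive.SubGss W 3 → W.analyticRank = 0 → Literature.NumberTheory.EllipticCurves.Rank1Residual.Typed.MissingUpperBoundAt W 3

/-- item stmt-BirchSwinnertonDyer-32276 · crux · rank 302 · open · by planner
why it might fail: Not in print (Kohen–Pacetti Rem. 3.8). Class-blind: at an additive 3 (9 ∣ M) a Cartan-frame Manin/congruence defect or an SAT₃ failure at a PS place of index 3 could break the +1 where the X11b (3 ∥ N) print derivation p766447 cannot see it; no 9 ∣ N CDEG3 datum yet.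
sources: KohenPacetti2016, Rem. 3.8 and §2 (arXiv:1403.7801v3), CaiShuTian2014, §1.2, Prop. 3.8 (arXiv:1408.1733), Ribet1990, Thm. 1, VignerasLNM800, Ch. III §5, DeligneSerre1974, Lemme 6.11 / §6.1, Zywina2015, Prop. 1.14
[crux] NUM♮ BY NAME — the CLASS-BLIND one-place degree law at a non-split Cartan place (director-bsd
(528) YES / (532)(b) 2026-08-30: statement = the route-independent constant
`CartanCorrespondence.CartanOnePlaceDegreeLawAtThreeNatural` of p768893 ✓ (LEAD tam3-p1 g36,
`Theorems/ClassRecordThreeCartanOnePlaceDegreeLawAtThreeNatural.lean`, commit 126406117d34; body =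
794 chars sig-sha16 dd477430ced6347c = this pen's `hnat` = stepL pen's text, byte-identical); ONE
ledger item by identical normalised signature across RamifiedHeegnerPair (crux r302 under U₁, here)
and ClassRecordThree / KolyvaginRoadThree (stepL pen files the same constant; first filer creates,
second attaches)): item 24801's body with the class binder `ClassX11b V 3 →` deleted and `Surj V 3`
kept (Surj ⇒ ¬CM ∧ E[3] irreducible are tree theorems): for V/ℚ with ρ̄_{V,3} onto, conductor N =
D·M·∏_{p∈C} p², a Cartan place q ∈ C (q ≠ 3, q³ ∤ N, 3 ∣ c_q(V)), class-minimal Cartan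
parametrisation data Q at (D, M; C) and Q′ at (D, Mq²; C∖q): ord₃ deg Q′ = ord₃ deg Q + 1. BY-NAME
CONSEQUENCES (LANDED one-liners of p768893: `cartanOnePlaceDegreeLawAtThree_of_natural` NUM♮ → NUM
24801, `leafCartanOnePlaceDegreeLawAtThree_of_natur -/
@[route_item "route-BirchSwinnertonDyer-RamifiedHeegnerPair", crux]
def CartanOnePlaceDegreeLawAtThreeNatural : Prop :=
  Summit.BirchSwinnertonDyer.BirchSwinnertonDyer.Theorems.CartanCorrespondence.CartanOnePlaceDegreeLawAtThreeNatural

/-- item stmt-BirchSwinnertonDyer-23191 · aside · rank 2 · open · by planner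
why it might fail: No signed Coleman map / bounded anticyclotomic 3-adic L-function is in print for a crystalline supersingular V₃ restricted to a RAMIFIED quadratic K_𝔭 (Kriz's 𝓛 is continuous, not Iwasawa; BKNO 2026 is CM, p ≥ 5); at p = 3 even the split-prime IMC ⊇ (Wan) is unproved.
sources: Kriz2021, arXiv:2608.06879, BurungaleBuyukbodukLei2024, CastellaWan2022, KitajimaOtsuki2018, Kobayashi2003
[crux] For every non-CM globally minimal E/ℚ additive of class Gss2 at 3, every squarefree d < 0
with v₃(d) = 1, and every globally minimal model V of E^(d) with good supersingular reduction at 3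
and r_an(E) + r_an(V) = 1: Ш_an(E), Ш_an(V) are rationals q, q′ with ord₃ q + ord₃ q′ ≤ ord₃ #Ш(E) +
ord₃ #Ш(V) (the LOWER half of BSD₃ for A = E/ℚ(√d), good supersingular at the ramified prime above
3, r_an(A/K) = 1: Heegner-point main conjecture ⊇ / signed anticyclotomic IMC over a 3-ramified K,
or an exact 3-indivisibility of the CM-point index). [difficulty: open-problem] -/
@[route_item "route-BirchSwinnertonDyer-RamifiedHeegnerPair"]
def RamifiedPairLowerBound : Prop :=
  ∀ (W : WeierstrassCurve ℚ) [W.IsElliptic] [W.IsGloballyMinimal] (V : WeierstrassCurve ℚ) [V.IsElliptic] [V.IsGloballyMinimal] (d : ℤ), ¬ W.HasCM → Literature.NumberTheory.EllipticCurves.Rank1Residual.Addv W 3 → Summit.BirchSwinnertonDyer.Rank1Residual.Additive.SubGss W 3 → d < 0 → padicValInt 3 d = 1 → Squarefree d → (∃ C : WeierstrassCurve.VariableChange ℚ, C • W.quadraticTwist (d : ℚ) = V) → Literature.NumberTheory.EllipticCurves.Rank1Residual.GoodSS V 3 → W.analyticRank + V.analyticRank = 1 → ∃ q q' : ℚ,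 Literature.NumberTheory.EllipticCurves.shaAn W = (q : ℂ) ∧ Literature.NumberTheory.EllipticCurves.shaAn V = (q' : ℂ) ∧ padicValRat 3 q + padicValRat 3 q' ≤ (padicValNat 3 W.shaOrder : ℤ) + (padicValNat 3 V.shaOrder : ℤ)

/-- item stmt-BirchSwinnertonDyer-23192 · aside · rank 3 · open · by planner
why it might fail: Nekovář 2007 gives finiteness, not the 3-exact index bound; at joint ramification the CST index carries c₃(E) ∈ {1,2,4}, #Ẽ_V(𝔽₃) ∈ {1,4,7} and deg f/(f,f)_U, and on the 98 r1 classes with ρ̄₃ not onto no Kolyvagin bound at 3 is in print.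
sources: Nekovar2007, CaiShuTian2014, arXiv:1408.1733, Kolyvagin1990, KolyvaginLogachev1992, Jetchev2008
[crux] Same hypotheses; conclusion ord₃ #Ш(E) + ord₃ #Ш(V) ≤ ord₃ q + ord₃ q′ (the UPPER half of
BSD₃ for A = E/K over the 3-ramified K: Kolyvagin's Euler system of CM points on the Cai–Shu–Tian
Shimura curve X_U of level U₀(N) with 9 ∣ N and 3 ∣ d_K, Nekovář 2007 Thm 3.2 made p-exact at p = 3,
combined with the explicit Gross–Zagier formula CST14 Thm 1.5 / Special case 2 turning the height of
the CM point into L′(A/K,1) with the local factor 2⁻¹·(Euler factor at 𝔭 removed)). [difficulty: XL] -/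
@[route_item "route-BirchSwinnertonDyer-RamifiedHeegnerPair"]
def RamifiedPairUpperBound : Prop :=
  ∀ (W : WeierstrassCurve ℚ) [W.IsElliptic] [W.IsGloballyMinimal] (V : WeierstrassCurve ℚ) [V.IsElliptic] [V.IsGloballyMinimal] (d : ℤ), ¬ W.HasCM → Literature.NumberTheory.EllipticCurves.Rank1Residual.Addv W 3 → Summit.BirchSwinnertonDyer.Rank1Residual.Additive.SubGss W 3 → d < 0 → padicValInt 3 d = 1 → Squarefree d → (∃ C : WeierstrassCurve.VariableChange ℚ, C • W.quadraticTwist (d : ℚ) = V) → Literature.NumberTheory.EllipticCurves.Rank1Residual.GoodSS V 3 → W.analyticRank + V.analyticRank = 1 → ∃ q q' : ℚ, Literature.NumberTheory.EllipticCurves.shaAn W = (q : ℂ) ∧ Literature.NumberTheory.EllipticCurves.shaAn V = (q' : ℂ) ∧ (padicValNat 3 W.shaOrder : ℤ) + (padicValNat 3 V.shaOrder : ℤ) ≤ padicValRat 3 q + padicValRat 3 q'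

/-- item stmt-BirchSwinnertonDyer-23193 · aside · rank 4 · open · by planner
why it might fail: It is itself open: signed IMC at p = 3 for non-semistable good supersingular curves (X7) and the a₃ = ±3 Sprung case (X8) have no printed proof; r0 X6 at 3 needs Wan's ⊇ at p = 3.
sources: Kobayashi2003, Sprung2012, Sprung2017, CastellaWan2022, BurungaleBuyukbodukLei2024
[crux] RESIDUAL (declared, not attacked): for every non-CM globally minimal V/ℚ with GOOD
supersingular reduction at 3 (a₃ ∈ {0, ±3}) and r_an(V) ≤ 1, BSD₃(V) — the p = 3 slices of W-ALL
rows 6 (X6 ∧ r = 0), 7 (X7: non-semistable, leaf `WAllCornerX7AtThree`) and 8 (X8: a₃ = ±3, leaf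
`WAllCornerX8`) together with the printed X6 ∧ r = 1 road (Kobayashi 2013 Cor 1.4 binder of
CornersAll); consumed only for the GOOD partner V. [difficulty: open-problem] -/
@[route_item "route-BirchSwinnertonDyer-RamifiedHeegnerPair", crux]
def GoodSupersingularAtThree : Prop :=
  ∀ (V : WeierstrassCurve ℚ) [V.IsElliptic] [V.IsGloballyMinimal], ¬ V.HasCM → Literature.NumberTheory.EllipticCurves.Rank1Residual.GoodSS V 3 → V.analyticRank ≤ 1 → Literature.NumberTheory.EllipticCurves.BSDp V 3

/-- item stmt-BirchSwinnertonDyer-19266 · aside · rank 9 · open · by planner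
sources: BreuilConradDiamondTaylor2001
[support] modularity of E/ℚ as parametrisation data (Breuil–Conrad–Diamond–Taylor 2001 Thm A), BY
NAME — conjunct of OrdPublishedInputsAtTwo (19149; Literature.Uncategorized.OrdPublishedInputsAtTwo
l.26); same content, filed so the head constant is item-stated (#15c one rule; cite_only dep) -/
@[route_item "route-BirchSwinnertonDyer-RamifiedHeegnerPair"]
def ModularParametrizationDatum : Prop :=
  Literature.NumberTheory.EllipticCurves.ModularForms.nonempty_modularParametrizationData

/-- item stmt-BirchSwinnertonDyer-19273 · aside · rank 9 · open · by planner
sources: BreuilConradDiamondTaylor2001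
[support] entire continuation of L(E/ℚ, s) (modularity: Breuil–Conrad–Diamond–Taylor 2001 Thm A +
Hecke/Shimura), BY NAME — conjunct of MultConversePublishedInputsAtTwo (19185); same content, filed
so the head constant is item-stated (#15c one rule; cite_only dep) -/
@[route_item "route-BirchSwinnertonDyer-RamifiedHeegnerPair"]
def EntireLFunctionRat : Prop :=
  WeierstrassCurve.hasEntireLFunction_rat

/-- item stmt-BirchSwinnertonDyer-19307 · aside · rank 9 · open · by operator
sources: Cassels1965ArithmeticVIII, MilneADT2006
[support] Cassels 1965 (Arithmetic on curves of genus 1, VIII; J. reine angew. Math. 217) / Milne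
ADT Thm I.7.3 and Rem I.7.4: the BSD quotient (right-hand side of the BSD formula) is invariant
under isogeny over ℚ — conjunct of the support PrintedFacts (stmt-BirchSwinnertonDyer-19362), BY
NAME; same content, filed as a split child so the head constant is item-stated (gate5 #15c one rule;
readiness rule 2026-08-15: cite_only dep declared by the route; director-bsd 2026-08-26T04:22Z
«K3/E2 shape»); no crux statement / closes / tribunal change -/
@[route_item "route-BirchSwinnertonDyer-RamifiedHeegnerPair"]
def CasselsIsogenyInvariance : Prop :=
  WeierstrassCurve.bsdRHS_eq_of_isIsogenous

/-- item stmt-BirchSwinnertonDyer-19369 · aside · rank 9 · open · by planner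
sources: GrossZagier1986
[aside] Gross–Zagier 1986 Thm. I.(7.3) (p. 231; proof V.§2 pp. 310–313): L′(E,1) ≠ 0 ⇒ a rational
point of infinite order (via a Heegner point and the GZ formula) — a cite_only dep of this route
reached through the depth-1 support item PublishedInputsIMCReduction
(stmt-BirchSwinnertonDyer-19283, child of 19061; a third item layer is forbidden, so it is
item-stated here as a by-name ASIDE: banked context, never staffed, BC6-exempt; gate5 02:15:40Z
«aside also counts»); no crux statement / closes / tribunal change -/
@[route_item "route-BirchSwinnertonDyer-RamifiedHeegnerPair"]
def PublishedInputGZ73 : Prop :=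
  Literature.NumberTheory.EllipticCurves.GrossZagier1986_thm_I_7_3

/-- item stmt-BirchSwinnertonDyer-19372 · aside · rank 9 · open · by planner
sources: HoffsteinLuo1997
[aside] Hoffstein–Luo 1997 Theorem (§1, pp. 435–436), as used in Matsuno 2009 proof of Prop. 6.1: a
quadratic twist with L(E^D,1) ≠ 0 under prescribed local conditions — conjunct of
PublishedInputsFive (stmt-BirchSwinnertonDyer-19066) kept inside the k = 7 rest child
ClassicalAndTwistInputsFive and item-stated here BY NAME as an ASIDE (banked context, never staffed,
BC6-exempt) so the cite_only dep is declared (#15c); no crux statement / closes / tribunal change -/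
@[route_item "route-BirchSwinnertonDyer-RamifiedHeegnerPair"]
def HoffsteinLuoNonvanishingTwist : Prop :=
  Literature.NumberTheory.EllipticCurves.HoffsteinLuo1997_exists_twist_L_one_ne_zero

/-- item stmt-BirchSwinnertonDyer-19383 · aside · rank 9 · closed · proved by Summit.BirchSwinnertonDyer.BirchSwinnertonDyer.Theorems.ManinLocalTwoThree.MazurManinConstantOddPrimes_proof (prover) · by planner
sources: Mazur1978
[support] Mazur 1978 Cor. 4.1 (with Edixhoven 1991 Prop. 2: c ∈ ℤ): for every odd prime p with p² ∤
N the Manin constant is prime to p — conjunct of PublishedInputsFive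
(stmt-BirchSwinnertonDyer-19066), BY NAME; same content, filed as a split child so the head constant
is item-stated (gate5 #15c one rule / readiness rule 2026-08-15: a cite_only dep must be declared by
the route); no crux statement / closes / tribunal / tribunal_fit change -/
@[route_item "route-BirchSwinnertonDyer-RamifiedHeegnerPair"]
def MazurManinConstantOdd : Prop :=
  Literature.NumberTheory.EllipticCurves.ModularForms.mazur_not_dvd_maninConstant_of_odd

/-- `MazurManinConstantOdd` holds: proved by `Summit.BirchSwinnertonDyer.BirchSwinnertonDyer.Theorems.ManinLocalTwoThree.MazurManinConstantOddPrimes_proof`. -/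
theorem MazurManinConstantOdd_holds : MazurManinConstantOdd := _root_.Summit.BirchSwinnertonDyer.BirchSwinnertonDyer.Theorems.ManinLocalTwoThree.MazurManinConstantOddPrimes_proof

/-- item stmt-BirchSwinnertonDyer-19414 · aside · rank 9 · open · by operator
sources: McCallumLMS1991, Kolyvagin1990, GrossLMS1991
[support] McCallum 1991 (LMS LN 153) §5 Cor. 5.6 (p. 310), M_r and Lemma 5.1 (p. 303), Thm. 5.4 (p.
308), §4 S_r(M) (pp. 299–300); Kolyvagin 1991 Math. Ann. §1 B(E) p. 254; Gross 1991 §4 (4.1): the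
Kolyvagin–McCallum structure bound p^{…} ∣ #Ш[p^∞] from a derived-class certificate — conjunct of
PublishedInputsKolyThree (stmt-BirchSwinnertonDyer-19156), BY NAME; same content, filed as a split
child so the head constant is item-stated (gate5 #15c one rule / readiness rule 2026-08-15: a
cite_only dep must be declared by the route); no crux statement / closes / tribunal / tribunal_fit
change -/
@[route_item "route-BirchSwinnertonDyer-RamifiedHeegnerPair"]
def McCallumShaStructureCertificate : Prop :=
  Literature.NumberTheory.EllipticCurves.McCallum1991_pow_dvd_card_sha_primary_of_certificate

/-- item stmt-BirchSwinnertonDyer-19421 · aside · rank 9 · open · by planner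
sources: Kato2004Asterisque, GreenbergLNM1716
[support, cite-level BY-NAME ALIAS of a published input — never a prover target; held] Kato 2004
Thm. 14.5 (3) ⊕ Prop. 14.16 (2) in the Tamagawa-EXACT, Manin-free reading with Greenberg LNM 1716
Prop. 4.13 (A161″): `ord_p #Ш + v_p Tam ≤ ord_p L(E,1)/Ω` at an additive potentially good p for im ρ
⊇ SL₂(ℤ_p). Conjunct 1 of `KatoTamagawaExactInputs` (stmt 19191); filed under this split ONLY to
item-state the constant (the generated glue does not use it) — a by-name alias, not a decomposition. -/
@[route_item "route-BirchSwinnertonDyer-RamifiedHeegnerPair"]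
def PublishedInputKatoA161Tamagawa : Prop :=
  Literature.NumberTheory.EllipticCurves.Kato2004.rankZero_padicValNat_sha_add_padicValNat_tamagawa_le_of_additive_potGood_of_imageContainsSL2

/-- item stmt-BirchSwinnertonDyer-19921 · support · rank 9 · open · by operator
sources: GrossZagier1986, Kolyvagin1990
[support] The one PUBLISHED input the halves-glue consumes: Gross–Zagier–Kolyvagin, rank = analytic
rank for analytic rank ≤ 1 with Ш finite (tree named fact
rank_eq_analyticRank_of_analyticRank_le_one; used by bsdp_of_missingPPartAt to turn Miller's last
clause into BSD(E,2)). Carried as a displayed PUB hypothesis; never counted as progress. The further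
PRINT of the roads to the two halves (Greenberg Thm-4.1 analogues at a multiplicative prime
thm41Analogue_charValue_rankZero_numberField_anyPrime / …_split_baseChange_anyPrime, modularity) and
the referee-passed MEMO inputs (Kato ⊗ℚ at a multiplicative 2:
X5.O1.KatoMultiplicativeDivisibilityRat W 2, HOME mult/PROOF-MULT.md RC-2; Greenberg–Stevens at 2:
greenberg_stevens W 2, mult/PROOF-GS2.md RC-4) enter the LINES under the halves (bridge
multiplicativeRankZeroAtTwo_of_muRoad, p409679), not this glue. -/
@[route_item "route-BirchSwinnertonDyer-RamifiedHeegnerPair", crux]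
def PublishedInputGZK : Prop :=
  Literature.NumberTheory.EllipticCurves.rank_eq_analyticRank_of_analyticRank_le_one

/-- item stmt-BirchSwinnertonDyer-20090 · aside · rank 9 · closed · proved by Summit.BirchSwinnertonDyer.BirchSwinnertonDyer.Theorems.ManinLocalTwoThree.AbbesUllmoManinConstantGoodPrimes_proof (prover) · by planner
sources: AbbesUllmo1996
[support] BY NAME, cite_only input: Abbes–Ullmo 1996 Thm A — for the lattice-optimal datum and p ∤
N, p ∤ c (`abbesUllmo_not_dvd_maninConstant_of_not_dvd_level`); consumed by
`not_dvd_maninConstant_of_kodairaSymbolAt_eq_Istar`. [difficulty: hypothesis-only] -/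
@[route_item "route-BirchSwinnertonDyer-RamifiedHeegnerPair"]
def AbbesUllmoManinConstant : Prop :=
  Literature.NumberTheory.EllipticCurves.ModularForms.abbesUllmo_not_dvd_maninConstant_of_not_dvd_level

/-- `AbbesUllmoManinConstant` holds: proved by `Summit.BirchSwinnertonDyer.BirchSwinnertonDyer.Theorems.ManinLocalTwoThree.AbbesUllmoManinConstantGoodPrimes_proof`. -/
theorem AbbesUllmoManinConstant_holds : AbbesUllmoManinConstant := _root_.Summit.BirchSwinnertonDyer.BirchSwinnertonDyer.Theorems.ManinLocalTwoThree.AbbesUllmoManinConstantGoodPrimes_proof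

/-- item stmt-BirchSwinnertonDyer-20091 · aside · rank 9 · closed · proved by Summit.BirchSwinnertonDyer.BirchSwinnertonDyer.Theorems.ManinLocalTwoThree.CesnaviciusManinConstantAtTwo_proof (prover) · by planner
sources: Cesnavicius2018
[support] BY NAME, cite_only input: Česnavičius 2018 Thm 1.2 (2 ∥ N ⇒ 2 ∤ c for the lattice-optimal
datum; `cesnavicius_not_two_dvd_maninConstant_of_two_dvd_level`) — a hypothesis of the tree theorem
`not_dvd_maninConstant_of_kodairaSymbolAt_eq_Istar` as typed (its semistable-twist step is
prime-uniform); not used at the odd p of this route otherwise. [difficulty: hypothesis-only] -/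
@[route_item "route-BirchSwinnertonDyer-RamifiedHeegnerPair"]
def CesnaviciusManinConstantTwo : Prop :=
  Literature.NumberTheory.EllipticCurves.ModularForms.cesnavicius_not_two_dvd_maninConstant_of_two_dvd_level

/-- `CesnaviciusManinConstantTwo` holds: proved by `Summit.BirchSwinnertonDyer.BirchSwinnertonDyer.Theorems.ManinLocalTwoThree.CesnaviciusManinConstantAtTwo_proof`. -/
theorem CesnaviciusManinConstantTwo_holds : CesnaviciusManinConstantTwo := _root_.Summit.BirchSwinnertonDyer.BirchSwinnertonDyer.Theorems.ManinLocalTwoThree.CesnaviciusManinConstantAtTwo_proof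

/-- item stmt-BirchSwinnertonDyer-20446 · aside · rank 9 · open · by planner
sources: MatarNekovar2019
[aside] Matar–Nekovář 2019 Thm 0.7 (Kolyvagin 1991 Thm C/D; McCallum 1991 §5 Cor 5.6) as the tree's
named fact, stated alone for the deps census (item-states); the Ko split's support child
KolyvaginStructureInputsAtThree (20761) carries it inside a conjunction together with `∀ N W K,
kolyvagin N W K`. Not a target: banked context only. -/
@[route_item "route-BirchSwinnertonDyer-RamifiedHeegnerPair"]
def PublishedInputMatarNekovarThm07 : Prop :=
  Literature.NumberTheory.EllipticCurves.MatarNekovar2019.thm07_padicValNat_card_sha_primary_add_le_of_globalDivisibility_of_irreducible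

/-- item stmt-BirchSwinnertonDyer-23194 · aside · rank 9 · open · by planner
sources: FriedbergHoffstein1995, BumpFriedbergHoffstein1990, MurtyMurty1991
[support] For every non-CM globally minimal E/ℚ additive of class Gss2 at 3 with r_an(E) ≤ 1 there
are a squarefree d < 0 with v₃(d) = 1 and a globally minimal model V of E^(d), non-CM, with GOOD
supersingular reduction at 3 and r_an(E) + r_an(V) = 1 (Gss2 ⇒ E ⊗ χ_d is good at 3 for 3 ‖ d: the d
= −3 case is the tree lemma O5.exists_goodSS_twist_pStar_of_subGss, general d by an unramified-at-3
twist on top; complementary analytic rank from Friedberg–Hoffstein 1995 Thm B with prescribed local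
class at 3 and ∞ when r_an(E) = 1, Bump–Friedberg–Hoffstein / Murty–Murty simple-zero twists when
r_an(E) = 0). [difficulty: L] -/
@[route_item "route-BirchSwinnertonDyer-RamifiedHeegnerPair"]
def RamifiedTwistSupply : Prop :=
  ∀ (W : WeierstrassCurve ℚ) [W.IsElliptic] [W.IsGloballyMinimal], ¬ W.HasCM → Literature.NumberTheory.EllipticCurves.Rank1Residual.Addv W 3 → Summit.BirchSwinnertonDyer.Rank1Residual.Additive.SubGss W 3 → W.analyticRank ≤ 1 → ∃ (d : ℤ) (V : WeierstrassCurve ℚ) (_ : V.IsElliptic) (_ : V.IsGloballyMinimal), d < 0 ∧ padicValInt 3 d = 1 ∧ Squarefree d ∧ (∃ C : WeierstrassCurve.VariableChange ℚ, C • W.quadraticTwist (d : ℚ) = V) ∧ ¬ V.HasCM ∧ Literature.NumberTheory.EllipticCurves.Rank1Residual.GoodSS V 3 ∧ W.analyticRank + V.analyticRank = 1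

/-- item stmt-BirchSwinnertonDyer-25112 · aside · rank 9 · SPLIT (gen 1) into PublishedInputBFH, PublishedInputFH, NewformOfEllipticCurve, PublishedInputParity + glue PublishedInputTwistsGlue · direct attempts still welcome (low priority) · by planner
sources: BumpFriedbergHoffstein1990, FriedbergHoffstein1995, MurtyMurty1991
[support] DISPLAYED published inputs for the ramified twist supply, HELD by name like
PublishedInputGZK (19921): Bump–Friedberg–Hoffstein 1990 (i) (simple-zero twists by Heegner fields
with prescribed splitting) ∧ Friedberg–Hoffstein 1995 Thm B(1) (non-vanishing twists with prescribed
local classes) ∧ modularity (exists_isNewformOf) ∧ parity of the analytic rank vs the root number.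
Option A′ of TURNKEY-23194 (utd-p3 g8 / trib-w-rhp g3 §3; director-bsd g12 (145)(b)). [difficulty:
input] -/
@[route_item "route-BirchSwinnertonDyer-RamifiedHeegnerPair"]
def PublishedInputTwists : Prop :=
  Literature.NumberTheory.EllipticCurves.bumpFriedbergHoffstein_exists_heegnerField_split_twist_simpleZero ∧ Literature.NumberTheory.EllipticCurves.friedbergHoffstein_exists_heegnerField_splitDivisors_twist_ne_zero ∧ Literature.NumberTheory.EllipticCurves.ModularForms.exists_isNewformOf ∧ (∀ W : WeierstrassCurve ℚ, Literature.NumberTheory.EllipticCurves.even_analyticRank_iff_rootNumber_eq_one W)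

-- parent: PublishedInputTwists · child (gen 1)
/--     item stmt-BirchSwinnertonDyer-25006 · support · rank 901 · open
    parent: PublishedInputTwists · by planner
    sources: BumpFriedbergHoffstein1990
[print input, BY NAME — director-bsd 02:13:39Z 'close 24304 (BFH tree fact)']
Bump–Friedberg–Hoffstein 1990 Theorem (i) (S-split, D<0 form): for w(E)=+1 and any finite S, B there
is an imaginary quadratic Heegner field K with |d_K|>B, every q ∈ S split, and L(E^{(d_K)},s) having
a simple zero at 1 — tree fact bumpFriedbergHoffstein_exists_heegnerField_split_twist_simpleZero. -/
@[route_item "route-BirchSwinnertonDyer-RamifiedHeegnerPair"]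
def PublishedInputBFH : Prop :=
  Literature.NumberTheory.EllipticCurves.bumpFriedbergHoffstein_exists_heegnerField_split_twist_simpleZero

-- parent: PublishedInputTwists · child (gen 1)
/--     item stmt-BirchSwinnertonDyer-19449 · support · rank 902 · open
    parent: PublishedInputTwists · by planner
    sources: FriedbergHoffstein1995
[aside] Friedberg–Hoffstein 1995 Thm. B (special case; with Waldspurger / Bump–Friedberg–Hoffstein):
a Heegner field K for N with prescribed primes SPLIT and L(E^{d_K},1) ≠ 0 (used by HeegnerTwistData
19183 to supply the B6 Heegner datum at an additive p) — a cite_only dep of this route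
(deps.unproved, rev 6), item-stated here as a BY-NAME ASIDE so the route's dependency cone is
declared (gate5 02:15:40Z «aside also counts»; ErratumRoadFive 19369–19375 / K1 19303–19307
precedent): banked context, never staffed, BC6-exempt, closes only by formalisation; no crux
statement / closes / tribunal / tribunal_fit change. Filed by the route base unit P2 g8 for
STAFFABLE (director-bsd 04:57:54Z E2). sources: FriedbergHoffstein1995, JetchevSkinnerWan2017 §7.4.1 -/
@[route_item "route-BirchSwinnertonDyer-RamifiedHeegnerPair"]
def PublishedInputFH : Prop :=
  Literature.NumberTheory.EllipticCurves.friedbergHoffstein_exists_heegnerField_splitDivisors_twist_ne_zero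

-- parent: PublishedInputTwists · child (gen 1)
/--     item stmt-BirchSwinnertonDyer-19382 · support · rank 903 · open
    parent: PublishedInputTwists · by planner
    sources: DiamondShurman2005, BCDTJAMS2001
[support] Modularity Theorem, Version L (Diamond–Shurman 2005 Thm. 8.8.3; Wiles / Taylor–Wiles /
BCDT 2001 Thm. A): every E/ℚ has a weight-2 newform f of level N_E with L(f,s) = L(E,s) — conjunct
of PublishedInputsFive (stmt-BirchSwinnertonDyer-19066), BY NAME; same content, filed as a split
child so the head constant is item-stated (gate5 #15c one rule / readiness rule 2026-08-15: a
cite_only dep must be declared by the route); no crux statement / closes / tribunal / tribunal_fit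
change -/
@[route_item "route-BirchSwinnertonDyer-RamifiedHeegnerPair"]
def NewformOfEllipticCurve : Prop :=
  Literature.NumberTheory.EllipticCurves.ModularForms.exists_isNewformOf

-- parent: PublishedInputTwists · child (gen 1)
/--     item stmt-BirchSwinnertonDyer-25143 · support · rank 904 · open
    parent: PublishedInputTwists · by planner
    sources: SilvermanAEC2009
[support] parity of the analytic rank vs the global root number (Silverman AEC 2009 C.16 Thm 16.3 +
remark p. 451; the converse direction via modularity, tree:
even_analyticRank_iff_rootNumber_eq_one_of_modularity) — conjunct 4 of PublishedInputTwists (25112)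
BY NAME, split child. [difficulty: provable-now from NewformOfEllipticCurve] -/
@[route_item "route-BirchSwinnertonDyer-RamifiedHeegnerPair"]
def PublishedInputParity : Prop :=
  ∀ W : WeierstrassCurve ℚ, Literature.NumberTheory.EllipticCurves.even_analyticRank_iff_rootNumber_eq_one W

-- parent: PublishedInputTwists · glue (gen 1)
/--     item stmt-BirchSwinnertonDyer-25144 · support · rank 905 · closed · proved by Summit.BirchSwinnertonDyer.BirchSwinnertonDyer.Theorems.publishedInputTwistsGlue_proof (prover)
    parent: PublishedInputTwists · GLUE: children ⟹ parent · by planner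
conjunction introduction: PublishedInputBFH → PublishedInputFH → NewformOfEllipticCurve →
PublishedInputParity → PublishedInputTwists (term: fun a b c d => ⟨a, b, c, d⟩; anyone idle) -/
@[route_item "route-BirchSwinnertonDyer-RamifiedHeegnerPair"]
def PublishedInputTwistsGlue : Prop :=
  PublishedInputBFH → PublishedInputFH → NewformOfEllipticCurve → PublishedInputParity → PublishedInputTwists

-- `PublishedInputTwistsGlue` holds: proved by `Summit.BirchSwinnertonDyer.BirchSwinnertonDyer.Theorems.publishedInputTwistsGlue_proof` (its module imports this route file, so no `_holds` link can be stated here).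

/-- item stmt-BirchSwinnertonDyer-25113 · support · rank 9 · closed · proved by Summit.BirchSwinnertonDyer.BirchSwinnertonDyer.Theorems.ramifiedTwistSupplyOfPub_proof (prover) · by planner
sources: FriedbergHoffstein1995, BumpFriedbergHoffstein1990, MurtyMurty1991
[support] The ramified twist supply MODULO the displayed inputs: PublishedInputTwists → ⟨item 23194
RamifiedTwistSupply body VERBATIM⟩ (for every non-CM globally minimal Gss2-at-3 curve with r_an ≤ 1:
a squarefree d < 0 with v₃(d) = 1 and a globally minimal non-CM model V of E^(d) with good
supersingular reduction at 3 and r_an(E) + r_an(V) = 1). Supersedes 23194 (→ aside; never reworded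
in place). Closes by the ONE-LINE Theorems file `theorem … : RamifiedTwistSupplyOfPub := fun hT =>
RamifiedTwistSupplyStubs.ramifiedTwistSupply_of hT` (assembly kernel-checked in p599181; stubs
p598076/p597891/p598764/p598402). [difficulty: provable-now] -/
@[route_item "route-BirchSwinnertonDyer-RamifiedHeegnerPair"]
def RamifiedTwistSupplyOfPub : Prop :=
  PublishedInputTwists → ∀ (W : WeierstrassCurve ℚ) [W.IsElliptic] [W.IsGloballyMinimal], ¬ W.HasCM → Literature.NumberTheory.EllipticCurves.Rank1Residual.Addv W 3 → Summit.BirchSwinnertonDyer.Rank1Residual.Additive.SubGss W 3 → W.analyticRank ≤ 1 → ∃ (d : ℤ) (V : WeierstrassCurve ℚ) (_ : V.IsElliptic) (_ : V.IsGloballyMinimal), d < 0 ∧ padicValInt 3 d = 1 ∧ Squarefree d ∧ (∃ C : WeierstrassCurve.VariableChange ℚ, C • W.quadraticTwist (d : ℚ) = V) ∧ ¬ V.HasCM ∧ Literature.NumberTheory.EllipticCurves.Rank1Residual.GoodSS V 3 ∧ W.analyticRank + V.analyticRank = 1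

-- `RamifiedTwistSupplyOfPub` holds: proved by `Summit.BirchSwinnertonDyer.BirchSwinnertonDyer.Theorems.ramifiedTwistSupplyOfPub_proof` (its module imports this route file, so no `_holds` link can be stated here).

/-- item stmt-BirchSwinnertonDyer-32139 · aside · rank 302 · open · by planner
why it might fail: Not in print (Kohen–Pacetti Rem. 3.8); sibling 24801 (X11b) open. A Cartan-frame Manin/congruence defect at the additive 3 (9 ∣ M) invisible at 3 ∥ N, or SAT₃ (Ihara-type saturation) failing at a principal-series place of index 3, breaks the +1; no 9 ∣ N case computed yet.
sources: KohenPacetti2016, Rem. 3.8 and §2 (arXiv:1403.7801v3), CaiShuTian2014, §1.2, Prop. 3.8 (arXiv:1408.1733), Ribet1990, Thm. 1, VignerasLNM800, Ch. III §5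
[crux] NUM_leaf (LEAD rhp-p2 g53 promote-stub outcome 2026-08-30T10:04Z; = registered stub
`stub_leafCartanOnePlaceDegreeLawAtThree` of `Cruxes/LeafRankOneUpperAtThree/Lines/nscartan.lean`
v16.3 4cbc3f8b0851a3ce VERBATIM, names qualified): the leaf ONE-PLACE DEGREE LAW at a non-split
Cartan place — the sibling item stmt-BirchSwinnertonDyer-24801
`CartanCorrespondence.CartanOnePlaceDegreeLawAtThree` (CR3/KR3) with `ClassX11b V 3` replaced by the
leaf class ¬CM ∧ Addv V 3 ∧ SubGss V 3 (then Surj V 3): for V of conductor N = D·M·∏_{p∈C} p², a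
Cartan place q ∈ C (q ≠ 3, q³ ∤ N, 3 ∣ c_q(V): Kodaira IV/IV*), class-minimal Cartan parametrisation
data Q at level (D, M; C) and Q′ at (D, Mq²; C∖q): ord₃ deg Q′ = ord₃ deg Q + 1. ROLE: with PRINT
(PUB⁺ 27491, FACTS″, SHIMURA+CARTAN facts incl. FH_sq₂ =
`friedbergHoffstein_exists_twist_ne_zero_inertAt_sq_splitTwo` p768129), L₀ 26023 and the residue
Σ★″|¬HabNs (⟸ 27493; HabNs holds on 33/33 known residue rows, N < 5·10⁵ ⇒ empty known support) it
yields U₁ 26022 (`Nscartan.LeafRankOneUpperAtThree_of`; display p767141, kernel p767743 + p767931,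
socket p764474; PICKED.md 2026-08-30). NUM 24801 and NUM_leaf are the two class instances of ONE
class-b -/
@[route_item "route-BirchSwinnertonDyer-RamifiedHeegnerPair"]
def LeafCartanOnePlaceDegreeLawAtThree : Prop :=
  ∀ (V : WeierstrassCurve ℚ) [V.IsElliptic] [V.IsGloballyMinimal], ¬ V.HasCM → Literature.NumberTheory.EllipticCurves.Rank1Residual.Addv V 3 → Summit.BirchSwinnertonDyer.Rank1Residual.Additive.SubGss V 3 → Literature.NumberTheory.EllipticCurves.Rank1Residual.Surj V 3 → ∀ (N D M : ℕ) (C : Finset ℕ) (q : ℕ) [Fact q.Prime] (X : Literature.NumberTheory.Automorphic.CartanLevelCurveData D M C) (W₁ : WeierstrassCurve ℚ) [W₁.IsElliptic] (Q : Literature.NumberTheory.Automorphic.CartanParametrizationData X W₁) (X' : Literature.NumberTheory.Automorphic.CartanLevelCurveData D (M * q ^ 2) (C.erase q)) (W₂ : WeierstrassCurve ℚ) [W₂.IsElliptic] (Q' : Literature.NumberTheory.Automorphic.CartanParametrizationData X' W₂), V.conductorNorm ℤ = N → D * M * ∏ p ∈ C, p ^ 2 = N → q ∈ C → q ≠ 3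 → ¬ q ^ 3 ∣ N → 3 ∣ (V.baseChange ℚ_[q]).localTamagawaNumber ℤ_[q] → Q.IsMinimalFor V → Q'.IsMinimalFor V → padicValNat 3 Q'.deg = padicValNat 3 Q.deg + 1

/-- item stmt-BirchSwinnertonDyer-27595 · aside · rank 305 · open · by planner
why it might fail: Not print on orphan rows: Takahashi 2001 Thm 2.4 has a gap and RT97 Thm 1(2)/Zhang's hypotheses fail when ρ̄_{V,3} is unramified at both primes of D (Ribet multiplicity two); a doubly-scalar pair (#V(ℚ_q)[3] = #V(ℚ_r)[3] = 9) may give 3 ∣ j_p(D,M) — PR Question (qR); no instance computed.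
sources: PapikianRabinoff2016, Thm. 37, Question (qR), Cor. 3.5, Rem. 38, Takahashi2001, Thm. 2.4 (gap), Thm. 2.7, RibetTakahashi1997, Thm. 1 (2nd assertion), Thm. 2, Zhang2014CJM, proof of the Ribet–Takahashi ℓ-exactness (Thm. 6.4 inputs), PastenShimura2024, §6.6, Prop. 6.13, Lemmas 6.14–6.18 (arXiv:1705.09251), AgasheRibetStein2012, Thm. 2.1
[crux] (G3) — KIND ASIDE r305 since rev 34 ((816)/(823)(a); LEAD g68: «not load-bearing for U₁/U₀»;
wanted_by RHP kept, not re-worded). PROMOTED STUB (LEAD rhp-p2 g56 `promote-stub`, 08-30; pen pss3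
g26, director (630)(a)); PARENT U₁ 26022 (serves U₀ 26024, no analytic-rank binder); statement =
partnerdescent v4.2's `def PartnerCokernelThreeFree` VERBATIM. SKELETONS OF RECORD (rev 36):
partnerdescent v14 189d0b4b71b1a57e / splitkolyvagin0 v27 3e98c0bf76c5e1c7 (LEAD g67 08-31; FIVE
stubs each, all ITEMS / cite-only NAMES) consume NEITHER this item NOR a weakening of it: the WEAKER
(G3♭ˢ) `PartnerCokernelThreeFreeFlatSplit` ⟸ this item (cokernel 3-free at r on a pair level D = qr,
q SPLIT, #V(ℚ_q)[3] ≠ 9 — the non-scalar range below), a stub at v5–v7, is since LEAD g63–g67 a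
THEOREM of the route's items + cite-only print (g61–g67: (C4) perfectness, congruence lattice s = r
p810424, ℤ₃ base change p814294, (HT) p817968, named facts DICT♭ p820894 / M1 p821944; route
rationale THE CUT); this item is the STRONGER class-wide research statement. CONTENT (LEAD's words):
Pasten's component-order package — Skolem functions i_p(D,M) = cI P p, j_p(D,M) = cJ P p of
`PastenShimura2024_componentOr -/
@[route_item "route-BirchSwinnertonDyer-RamifiedHeegnerPair"]
def PartnerCokernelThreeFree : Prop :=
  ∃ cI cJ : Literature.NumberTheory.Automorphic.ComponentOrderFun, (∀ {D M : ℕ} {X : Literature.NumberTheory.Automorphic.ShimuraCurveData D M} {W' : WeierstrassCurve ℚ} (P : Literature.NumberTheory.Automorphic.ShimuraParametrizationData X W') (p : ℕ), 0 < cI P p ∧ 0 < cJ P p) ∧ Literature.NumberTheory.Automorphic.ComponentOrders.ProductEq cI cJ ∧ Literature.NumberTheory.Automorphic.ComponentOrders.Prop613 cI cJ ∧ Literature.NumberTheory.Automorphic.ComponentOrders.ImageEisenstein cI ∧ Literature.NumberTheory.Automorphic.ComponentOrders.CokernelDvd cJ ∧ (∀ {N D M : ℕ}, Literature.NumberTheory.Automorphic.IsAdmissibleFactorization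 N D M → ∀ (X : Literature.NumberTheory.Automorphic.ShimuraCurveData D M) (V : WeierstrassCurve ℚ) [V.IsElliptic] [V.IsGloballyMinimal], V.conductorNorm ℤ = N → ¬ 3 ∣ N → Literature.NumberTheory.EllipticCurves.Rank1Residual.Irr V 3 → ∀ (V' : WeierstrassCurve ℚ) [V'.IsElliptic] (P : Literature.NumberTheory.Automorphic.ShimuraParametrizationData X V'), P.IsMinimalFor V → ∀ p : ℕ, p.Prime → p ∣ D → ¬ 3 ∣ cJ P p)

/-- item stmt-BirchSwinnertonDyer-23195 · assembly · rank 1 · closed · proved by Summit.BirchSwinnertonDyer.BirchSwinnertonDyer.Theorems.ramifiedHeegnerPair_assembly_proof (prover) · by planner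
sources: GrossZagier1986, Kolyvagin1990, CaiShuTian2014
[assembly] PublishedInputGZK → RamifiedTwistSupply → GoodSupersingularAtThree →
RamifiedPairUpperBound → RamifiedPairLowerBound → WAllExclAddGssAtThree (the registered W-ALL slice
leaf, Gss2 at 3; proved as `closes` in glue.lean). -/
@[route_item "route-BirchSwinnertonDyer-RamifiedHeegnerPair"]
def Assembly : Prop :=
  PublishedInputGZK → RamifiedTwistSupply → GoodSupersingularAtThree → RamifiedPairUpperBound → RamifiedPairLowerBound → Summit.BirchSwinnertonDyer.WAllExclAddGssAtThree

-- `Assembly` holds: proved by `Summit.BirchSwinnertonDyer.BirchSwinnertonDyer.Theorems.ramifiedHeegnerPair_assembly_proof` (its module imports this route file, so no `_holds` link can be stated here).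

/-! D-0027 §2.1 — DECIDING THEOREM (planner-authored via `route open/edit --closes-file`; by planner-bsd-wall-pss3-g16-0 2026-08-28T06:10:31Z):
its hypotheses are this route's items and its conclusion the registered leaf `Summit.BirchSwinnertonDyer.WAllExclAddGssAtThree` (rung W-ALL/2@3.GssAtThree, D-0061) (glue_lint), and it elaborates with this file. -/

@[closes "route-BirchSwinnertonDyer-RamifiedHeegnerPair"] theorem closes (hP : PublishedInputGZK) (hL1 : Gss2LowerAtThreeRankOne) (hU1 : LeafRankOneUpperAtThree)
    (hL0 : Gss2LowerAtThreeRankZero) (hU0 : LeafRankZeroUpperAtThree) :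
    Summit.BirchSwinnertonDyer.WAllExclAddGssAtThree := by
  intro W _ _ hCM hadd hsub hr
  rcases Nat.le_one_iff_eq_zero_or_eq_one.mp hr with h0 | h1
  · exact Literature.NumberTheory.EllipticCurves.Rank1Residual.Typed.bsdp_of_missingPPartAt W 3 hP hr
      (Literature.NumberTheory.EllipticCurves.Rank1Residual.Typed.missingPPartAt_of_lower_of_upper W 3
        (hL0 W hCM hadd hsub h0) (hU0 W hCM hadd hsub h0))
  · exact Literature.NumberTheory.EllipticCurves.Rank1Residual.Typed.bsdp_of_missingPPartAt W 3 hP hr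
      (Literature.NumberTheory.EllipticCurves.Rank1Residual.Typed.missingPPartAt_of_lower_of_upper W 3
        (hL1 W hCM hadd hsub h1) (hU1 W hCM hadd hsub h1))

end Summit.BirchSwinnertonDyer.BirchSwinnertonDyer.Theses.RamifiedHeegnerPair
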